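import Literature.Probability.RandomPlanarGeometry.HexSAWSurfaceSecondOrderSharp
import Literature.Probability.RandomPlanarGeometry.HexSAWSurfaceThirdOrderLower
import Literature.Probability.RandomPlanarGeometry.HexSAWSurfaceWallRateEq
import HarnessLib

/-!
# Honeycomb SAW at the Duminil-Copin–Smirnov surface (brick-wall frame): the THIRD-order term of the adsorbed-phase free energy —
# `β(y)² ≤ y + 1/y + 1/y² + 3¹¹/y³` from above (three-step-extendable arches) and, with the companion two-seed renewal,
# `β(y)² = y + 1/y + 1/y² + O(y⁻³)`: `y² (β(y)² − y − 1/y) → 1`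

Topic `Literature/Probability/RandomPlanarGeometry` (lane «pcv-sawmu», car «WALL-THIRD-ORDER-UPPER», a-p6 g15).  Continues
`HexSAWSurfaceSecondOrderSharp.lean` (same seat: extendable arches `ExtRow`/`archsX`/`Xw`, `not_mem_fibW_diag`, `sum_fibW_eq_zero_of_near`,
the sharp window `y + 1/y − 26247/y³ ≤ β(y)² ≤ y + 1/y + 8748/y²`, `wallRate_sq_le_add_div`, `y (β(y)² − y) → 1`) by raising the
extendability requirement from ONE fresh row-neighbour to a fresh self-avoiding THREE-step continuation, which is what separates the genuine
flat excursion of length eight from its «late hook» twin (dead after two forced steps); and `HexSAWSurfaceThirdOrderLower.lean` (same seat: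
the two-seed renewal `third_window_lower : β² ≤ y + C/y → y + 1/y + 1/y² − 3C/y³ − 4C/y⁴ ≤ β²`) for the assembly of §9.

Sources.  N. R. Beaton, M. Bousquet-Mélou, J. de Gier, H. Duminil-Copin, A. J. Guttmann, CMP 326 (2014) = arXiv:1109.0358v5, §3.1,
Proposition 5 (p. 9) and p. 10 (the first-order remark "`μ(y) ∼ √y`", after Rychlewski–Whittington 2011 — not held).  E. J. Janse van
Rensburg, *The Statistical Mechanics of Interacting Walks, Polygons, Animals and Vesicles* (OUP 2000), §3.3.2, Lemma 3.20.  J. M. Hammersley,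
G. M. Torrie, S. G. Whittington, J. Phys. A 15 (1982) 539, §2 (locator provisional, source not held).  I. G. Enting, I. Jensen, LNP 775 (2009),
§7.4.2, Fig. 7.10.  N. Madras, G. Slade, *The Self-Avoiding Walk* (1993), §1.2.

## What is proved (namespace `…SAW.HexBW.Wall`)

* §1–§2 `Ext3 n ω` (a fresh self-avoiding three-step continuation `z₁ z₂ z₃` in the half-plane), `archs3`, `X3w n y = X³_n(y)`;
  `WB_le_X3w` (wall bridges: straight on to the right), `X3w_le_Aw`, ★ `prefixWalk_mem_archs3` (prefix cut at a surface visit `≥ 3`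
  steps before the end).
* §3 `sum_fibre_lastV_le_X3`, `sum_fibW_le_X3` (`k ≤ m`), `sum_fibW_self_le_X3` (straight fibre restricted to `Ext3` arches: the prefix
  inherits `ω (m+3)`, `ω (m+4)` and the first site of `ω`'s own continuation).
* §4 `dip_coords3`, `sum_fibW_dip_le_X3` (the dip fibre under `Ext3`, as in the parent).
* §5 ★★ **`flat8_head`** (no extendability: four steps after the last surface visit the walk is at `(x+3σ,−1)` — turning back under the
  start meets `ω j` or resurfaces at `ω (j−1)`; depth `−2` cannot resurface in time) and ★★ **`flat8_coords`** (under `Ext3` the last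
  eight steps are the FLAT excursion `(x+σ,0)(x+σ,−1)(x+2σ,−1)(x+3σ,−1)(x+4σ,−1)(x+5σ,−1)(x+5σ,0)(x+6σ,0)`; the late hook
  `(x+5σ,0) → (x+4σ,0)` admits exactly the two forced fresh steps `(x+3σ,0) (x+2σ,0)` and no third); ★ `sum_fibW_flat8_le_X3 (1 ≤ j)`.
* §6 ★★ **`X3w_le_rec (1 ≤ j) : X³_{j+10} ≤ y X³_{j+8} + y X³_{j+4} + y X³_{j+2} + 2y Σ_{k≤j} X³_k c_{j+9−k}`** (`1 = yz + yz³ + yz⁴ + O(yz⁵)`).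
* §7 `X3w_le_mul_pow`: `6 ≤ ρ`, `y/ρ² + y/ρ⁶ + y/ρ⁸ + 78732 y/ρ¹⁰ ≤ 1 ⇒ X³_n ≤ 3¹⁰ y¹⁰ ρⁿ`.
* §8 ★★★ **`wallRate_sq_le_third (1 ≤ y) : β(y)² ≤ y + 1/y + 1/y² + 177147/y³`** (`ρ² = y + 1/y + 1/y² + 3¹¹/y³ ≥ 36` for every
  `y ≥ 1`, with equality at `y = 27`: `y⁴ − 36y³ + 3¹¹ = (y−27)²(y²+18y+243)`), ★★ `sq_mul_wallRate_sq_sub_sub_le : y² (β² − y − 1/y) ≤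
  1 + 3¹¹/y`, `eventually_sq_mul_wallRate_sq_sub_sub_le`.
* §9 ★★★ **THE THIRD-ORDER LAW**: `third_lower_window : y + 1/y + 1/y² − 26247/y³ − 34996/y⁴ ≤ β(y)²` (companion's two-seed window
  with `C = 8749`), `wallRate_sq_third_mem_Icc : β² − y − 1/y − 1/y² ∈ [−26247/y³ − 34996/y⁴, 3¹¹/y³]` ∀ y ≥ 1,
  `sq_mul_wallRate_sq_sub_sub_mem_Icc : y² (β² − y − 1/y) ∈ [1 − 26247/y − 34996/y², 1 + 3¹¹/y]`,
  ★★★ **`tendsto_sq_mul_wallRate_sq_sub_sub : y² (β(y)² − y − 1/y) → 1`**, `isBigO_wallRate_sq_third : β² − y − 1/y − 1/y² = O(y⁻³)`,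
  `eventually_abs_sq_mul_wallRate_sq_sub_sub_sub_one_le`.
* §10 the same for BBdGDCG's `μ(y) = HV.surfaceMu y` (`HexSAWSurfaceWallRateEq.wallRate_eq_surfaceMu`): ★★★
  `surfaceMu_sq_third_mem_Icc`, `tendsto_mul_surfaceMu_sq_sub` (→ 1), `tendsto_sq_mul_surfaceMu_sq_sub_sub` (→ 1), `tendsto_surfaceMu_sqrt_and_log`.

HONEST LABEL (author's proposal).  LANE THEOREM S, elementary; NEW-IN-WRITING (modest): **`β(y)² = y + 1/y + 1/y² + O(y⁻³)`** — the
second AND third coefficients of the large-fugacity expansion of the BBdGDCG surface growth rate are exactly one (dip, flat excursion of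
length eight; the hook and the late hook are dead ends).  Print has only the first order for this model (BBdGDCG p. 10, after RW11's square-
lattice `μ(y) ∼ y`); exactly solvable directed adsorption models (JvR 2000/2015 ch. 4) have closed-form free energies — different models.
NOT CLAIMED: the `O(y⁻³)` coefficient (the renewal predicts it is NOT 1: at cost 4 several pieces compete); the armchair wall; optimal
constants.  Presearch as in the parents (corpus + galaxy + held: none beyond the first order).
-/

noncomputable section

open Finset Filter Function
open Literature.Probability.LatticeModels Literature.Probability.Percolation SimpleGraph
open _root_.Topology

namespace Literature.Probability.RandomPlanarGeometry.SAW.HexBW.Wall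

variable {y : ℝ} {n : ℕ} {ω : ℕ → Site 2}

/-! ### §1  Three-step-extendable arches -/

/-- An `n`-step walk is **three-step extendable** if it admits a self-avoiding continuation by three fresh sites of the half-plane
`Y ≤ 0` (`z₁ z₂ z₃`, consecutive brick-wall neighbours, `z₁ ≠ z₃`, none visited during `[0, n]`).  Dead ends that die within three steps —
the «hook» after a dip (dies at once) and the «late hook» `(x+5σ,0) → (x+4σ,0)` after a flat excursion of length eight (dies after two
forced steps `(x+3σ,0) (x+2σ,0)`) — are not; wall bridges and prefixes cut at a surface visit at least three steps before the end are.
[cite: HammersleyTorrieWhittington1982, §2 (unfolded surface walks; locator provisional, source not held); MadrasSlade1993, §1.2, (1.2.3)] -/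
def Ext3 (n : ℕ) (ω : ℕ → Site 2) : Prop :=
  ∃ z₁ z₂ z₃ : Site 2, brickWallGraph.Adj (ω n) z₁ ∧ brickWallGraph.Adj z₁ z₂ ∧ brickWallGraph.Adj z₂ z₃ ∧
    z₁ 1 ≤ 0 ∧ z₂ 1 ≤ 0 ∧ z₃ 1 ≤ 0 ∧ z₁ ≠ z₃ ∧ ∀ i ≤ n, ω i ≠ z₁ ∧ ω i ≠ z₂ ∧ ω i ≠ z₃

open Classical in
/-- The three-step-extendable arches of length `n`. [cite: HammersleyTorrieWhittington1982, §2 (unfolded surface walks; locator provisional)] -/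
def archs3 (n : ℕ) : Finset (ℕ → Site 2) := (archs n).filter (Ext3 n)

open Classical in
/-- Their surface-weighted count `X³_n(y)`. [cite: HammersleyTorrieWhittington1982, §2 (unfolded surface walks; locator provisional)] -/
def X3w (n : ℕ) (y : ℝ) : ℝ := ∑ ω ∈ archs3 n, y ^ visits n ω

open Classical in
/-- Membership. [cite: HammersleyTorrieWhittington1982, §2] -/
theorem mem_archs3 : ω ∈ archs3 n ↔ ω ∈ archs n ∧ Ext3 n ω := Finset.mem_filter

open Classical in
/-- `archs3 n ⊆ archs n`. [cite: HammersleyTorrieWhittington1982, §2] -/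
theorem archs3_subset : archs3 n ⊆ archs n := Finset.filter_subset _ _

open Classical in
/-- `X³_n(y) ≥ 0`. [cite: HammersleyTorrieWhittington1982, §2] -/
theorem X3w_nonneg (n : ℕ) (hy : 0 ≤ y) : 0 ≤ X3w n y := Finset.sum_nonneg fun _ _ => pow_nonneg hy _

open Classical in
/-- `X³_n(y) ≤ A_n(y)`. [cite: HammersleyTorrieWhittington1982, §2] -/
theorem X3w_le_Aw (n : ℕ) (hy : 0 ≤ y) : X3w n y ≤ Aw n y :=
  Finset.sum_le_sum_of_subset_of_nonneg archs3_subset fun _ _ _ => pow_nonneg hy _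

/-- **Every wall bridge is three-step extendable**: straight on along the row to the right of its rightmost end.
[cite: HammersleyTorrieWhittington1982, §2 (surface bridges); BeatonBousquetMelouDeGierDuminilCopinGuttmann2014, §3.1 (arXiv v5 p. 9)] -/
theorem ext3_of_mem_wbr (hω : ω ∈ wbr n) : Ext3 n ω := by
  obtain ⟨hωa, hwb⟩ := mem_wbr.1 hω
  obtain ⟨hωh, -, hend⟩ := mem_archs.1 hωa
  refine ⟨Arm.pt (ω n 0 + 1) 0, Arm.pt (ω n 0 + 2) 0, Arm.pt (ω n 0 + 3) 0, ?_, ?_, ?_,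
    le_of_eq (Arm.pt_apply_one _ _), le_of_eq (Arm.pt_apply_one _ _), le_of_eq (Arm.pt_apply_one _ _), ?_, fun i hi => ⟨?_, ?_, ?_⟩⟩
  · rw [brickWallGraph_adj_coord, Arm.pt_apply_zero, Arm.pt_apply_one]; omega
  · rw [brickWallGraph_adj_coord, Arm.pt_apply_zero, Arm.pt_apply_one, Arm.pt_apply_zero, Arm.pt_apply_one]; omega
  · rw [brickWallGraph_adj_coord, Arm.pt_apply_zero, Arm.pt_apply_one, Arm.pt_apply_zero, Arm.pt_apply_one]; omega
  · intro h; have h0 := congrFun h 0; rw [Arm.pt_apply_zero, Arm.pt_apply_zero] at h0; omega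
  all_goals
    intro h
    have h0 := congrFun h 0
    rw [Arm.pt_apply_zero] at h0
    have := (hwb i hi).2
    omega

open Classical in
/-- `wbr n ⊆ archs3 n`. [cite: HammersleyTorrieWhittington1982, §2 (surface bridges)] -/
theorem wbr_subset_archs3 : wbr n ⊆ archs3 n := fun _ hω => mem_archs3.2 ⟨wbr_subset hω, ext3_of_mem_wbr hω⟩

open Classical in
/-- **`B^w_n(y) ≤ X³_n(y)`** (`y ≥ 0`). [cite: HammersleyTorrieWhittington1982, §2 (surface bridges)] -/
theorem WB_le_X3w (n : ℕ) (hy : 0 ≤ y) : WB n y ≤ X3w n y :=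
  Finset.sum_le_sum_of_subset_of_nonneg wbr_subset_archs3 fun _ _ _ => pow_nonneg hy _

/-- A three-step-extendable walk has, in particular, a fresh half-plane neighbour of its endpoint. [cite: HammersleyTorrieWhittington1982, §2] -/
theorem Ext3.exists_fresh (h : Ext3 n ω) : ∃ z : Site 2, brickWallGraph.Adj (ω n) z ∧ z 1 ≤ 0 ∧ ∀ i ≤ n, ω i ≠ z := by
  obtain ⟨z₁, z₂, z₃, h1, h2, h3, hz1, hz2, hz3, hne, hfresh⟩ := h
  exact ⟨z₁, h1, hz1, fun i hi => (hfresh i hi).1⟩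

/-! ### §2  Prefixes cut at a surface visit at least three steps before the end -/

/-- **The prefix of a half-plane walk up to a surface visit at an even time `k` with `k + 3 ≤ n` is a three-step-extendable arch**
(witnesses `ω (k+1)`, `ω (k+2)`, `ω (k+3)`), with the same visits up to time `k`. [cite: MadrasSlade1993, §1.2, (1.2.3); EntingJensen2009, §7.4.2, Fig. 7.10] -/
theorem prefixWalk_mem_archs3 (hω : ω ∈ hpw n) {k : ℕ} (hk : k + 3 ≤ n) (hk2 : k % 2 = 0) (hY : ω k 1 = 0) :
    Zd.prefixWalk k ω ∈ archs3 k ∧ visits k (Zd.prefixWalk k ω) = visits k ω := by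
  classical
  obtain ⟨hpa, hpv⟩ := prefixWalk_mem_archs hω (by omega) hk2 hY
  refine ⟨mem_archs3.2 ⟨hpa, ?_⟩, hpv⟩
  obtain ⟨hωs, hH⟩ := mem_hpw.1 hω
  obtain ⟨-, -, hbw, hinj⟩ := mem_saws_iff.1 hωs
  have hv : ∀ i ≤ k, Zd.prefixWalk k ω i = ω i := fun i hi => by simp [Zd.prefixWalk, min_eq_left hi]
  have hne : ∀ a b : ℕ, a ≤ n → b ≤ n → a ≠ b → ω a ≠ ω b := fun a b ha hb hab h =>
    hab (hinj (show a ∈ {j | j ≤ n} by simp only [Set.mem_setOf_eq]; exact ha)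
      (show b ∈ {j | j ≤ n} by simp only [Set.mem_setOf_eq]; exact hb) h)
  refine ⟨ω (k + 1), ω (k + 2), ω (k + 3), ?_, hbw (k + 1) (by omega), ?_, hH _ (by omega), hH _ (by omega), hH _ (by omega),
    hne _ _ (by omega) (by omega) (by omega), fun i hi => ⟨?_, ?_, ?_⟩⟩
  · rw [hv k le_rfl]; exact hbw k (by omega)
  · have := hbw (k + 2) (by omega); rwa [show k + 2 + 1 = k + 3 by omega] at this
  all_goals rw [hv i hi]; exact hne _ _ (by omega) (by omega) (by omega)

/-! ### §3  The last-visit fibres, with three-step-extendable prefixes -/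

open Classical in
/-- The walks of `hpw n` with last surface visit at time `k ≤ n − 3` weigh at most `X³_k(y) · c_{n−k}(ℍ)`. [cite: HammersleyTorrieWhittington1982, §2; MadrasSlade1993, §1.2, (1.2.3)] -/
theorem sum_fibre_lastV_le_X3 (hy : 0 ≤ y) {k : ℕ} (hk : k + 3 ≤ n) :
    ∑ ω ∈ (hpw n).filter (fun ω => lastV n ω = k), y ^ visits n ω ≤ X3w k y * #(saws (n - k)) := by
  set F := (hpw n).filter (fun ω => lastV n ω = k)
  have hF : ∀ ω ∈ F, ω ∈ hpw n ∧ lastV n ω = k := fun ω hω => Finset.mem_filter.1 hω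
  have hprops : ∀ ω ∈ F, visits n ω = visits k (Zd.prefixWalk k ω) ∧
      Zd.prefixWalk k ω ∈ archs3 k ∧ Zd.suffixWalk k (n - k) ω ∈ saws (n - k) := by
    intro ω hω
    obtain ⟨hωh, hl⟩ := hF ω hω
    have hωs := hpw_subset hωh
    obtain ⟨h0, -, -, -⟩ := mem_saws_iff.1 hωs
    obtain ⟨hk2, hY⟩ := lastV_spec (n := n) h0
    rw [hl] at hk2 hY
    obtain ⟨hpa, hpv⟩ := prefixWalk_mem_archs3 hωh hk hk2 hY
    refine ⟨?_, hpa, suffixWalk_mem hωs (by omega) hk2⟩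
    have e := visits_add_eq_left (k := k) (b := n - k) (ζ := ω)
      (fun j hj1 hjb => not_visit_of_lastV_lt (n := n) (ω := ω) (by omega) (by omega))
    rw [Nat.add_sub_cancel' (by omega : k ≤ n)] at e
    rw [hpv, e]
  have hinj : Set.InjOn (fun ω : ℕ → Site 2 => (Zd.prefixWalk k ω, Zd.suffixWalk k (n - k) ω)) ↑F :=
    fun ω hω ω' hω' h => Zd.prefix_suffix_injOn (by omega) (saws_subset _ (hpw_subset (hF ω hω).1))
      (saws_subset _ (hpw_subset (hF ω' hω').1)) h
  calc ∑ ω ∈ F, y ^ visits n ω = ∑ ω ∈ F, y ^ visits k (Zd.prefixWalk k ω) :=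
        Finset.sum_congr rfl fun ω hω => by rw [(hprops ω hω).1]
    _ = ∑ p ∈ F.image (fun ω => (Zd.prefixWalk k ω, Zd.suffixWalk k (n - k) ω)), y ^ visits k p.1 := by
        rw [Finset.sum_image hinj]
    _ ≤ ∑ p ∈ archs3 k ×ˢ saws (n - k), y ^ visits k p.1 := by
        refine Finset.sum_le_sum_of_subset_of_nonneg (fun p hp => ?_) fun _ _ _ => pow_nonneg hy _
        obtain ⟨ω, hω, rfl⟩ := Finset.mem_image.1 hp
        exact Finset.mem_product.2 ⟨(hprops ω hω).2.1, (hprops ω hω).2.2⟩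
    _ = X3w k y * #(saws (n - k)) := by
        rw [Finset.sum_product, X3w, Finset.sum_mul]
        refine Finset.sum_congr rfl fun φ _ => ?_
        dsimp only
        rw [Finset.sum_const, nsmul_eq_mul, mul_comm]

open Classical in
/-- **Every fibre `k ≤ m` of the arches of length `m+4`** weighs at most `2y · X³_k(y) · c_{m+3−k}(ℍ)` (the parent file's `sum_fibW_le`
with the three-step-extendable prefix count). [cite: HammersleyTorrieWhittington1982, §2 (as summarised by Beaton 2014 arXiv v3 p. 11; locator provisional); MadrasSlade1993, §1.2, (1.2.3)] -/
theorem sum_fibW_le_X3 (m : ℕ) (hy : 0 ≤ y) {k : ℕ} (hk : k ≤ m) :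
    ∑ ω ∈ fibW m k, y ^ visits (m + 4) ω ≤ 2 * y * (X3w k y * #(saws (m + 3 - k))) := by
  set F := (hpw (m + 3)).filter (fun ξ => lastV (m + 3) ξ = k) with hF
  set g : (ℕ → Site 2) → (ℕ → Site 2) × Bool :=
    fun ω => (Zd.prefixWalk (m + 3) ω, decide (ω (m + 4) 0 = ω (m + 3) 0 + 1)) with hg
  have hprops : ∀ ω ∈ fibW m k, (g ω).1 ∈ F ∧ visits (m + 4) ω = visits (m + 3) (g ω).1 + 1 := by
    intro ω hω
    obtain ⟨hωh, hm, hend, -, -, -, -, hlast⟩ := fibW_anatomy hω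
    obtain ⟨hph, hpv⟩ := prefixWalk_mem_hpw hωh (show m + 3 ≤ m + 4 by omega)
    have hl3 : lastV (m + 3) ω = k := by
      rw [show m + 3 = m + 2 + 1 by omega, lastV_succ_of_even (by omega), hlast]
    refine ⟨Finset.mem_filter.2 ⟨hph, (lastV_prefixWalk_eq _ _).trans hl3⟩, ?_⟩
    rw [show m + 4 = m + 3 + 1 by omega, visits_succ, hpv]
    have h4 : (m + 3 + 1) % 2 = 0 ∧ ω (m + 3 + 1) 1 = 0 := ⟨by omega, by rw [show m + 3 + 1 = m + 4 by omega]; exact hend⟩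
    rw [if_pos h4]
  have hinj : Set.InjOn g ↑(fibW m k) := by
    intro ω hω ω' hω' h
    rw [Finset.mem_coe] at hω hω'
    obtain ⟨hωh, -, hend, -⟩ := fibW_anatomy hω
    obtain ⟨hωh', -, hend', -⟩ := fibW_anatomy hω'
    have hωs := hpw_subset hωh
    have hωs' := hpw_subset hωh'
    simp only [hg, Prod.mk.injEq] at h
    obtain ⟨h1, h2⟩ := h
    have hagree : ∀ i ≤ m + 3, ω i = ω' i := fun i hi => by
      have := congrFun h1 i
      simpa [Zd.prefixWalk, min_eq_left hi] using this
    have hωa : ω ∈ archs (m + 3 + 1) := by rw [show m + 3 + 1 = m + 4 by omega]; exact (Finset.mem_filter.1 hω).1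
    have hωa' : ω' ∈ archs (m + 3 + 1) := by rw [show m + 3 + 1 = m + 4 by omega]; exact (Finset.mem_filter.1 hω').1
    obtain ⟨-, hX⟩ := arch_last_step hωa
    obtain ⟨-, hX'⟩ := arch_last_step hωa'
    rw [show m + 3 + 1 = m + 4 by omega] at hX hX'
    have e3 : ω (m + 3) 0 = ω' (m + 3) 0 := by rw [hagree (m + 3) le_rfl]
    have hb : (ω (m + 4) 0 = ω (m + 3) 0 + 1) ↔ (ω' (m + 4) 0 = ω' (m + 3) 0 + 1) := by
      simpa using h2
    refine Arm.eq_of_agree hωs hωs' fun i hi => ?_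
    rcases Nat.lt_or_ge i (m + 4) with hi' | hi'
    · exact hagree i (by omega)
    · have hin : i = m + 4 := le_antisymm hi hi'
      rw [hin, site_two_eq_iff]
      refine ⟨?_, by rw [hend, hend']⟩
      rcases hX with hX | hX <;> rcases hX' with hX' | hX'
      · omega
      · exact absurd (hb.1 hX) (by omega)
      · exact absurd (hb.2 hX') (by omega)
      · omega
  calc ∑ ω ∈ fibW m k, y ^ visits (m + 4) ω = ∑ ω ∈ fibW m k, y * y ^ visits (m + 3) (g ω).1 :=
        Finset.sum_congr rfl fun ω hω => by rw [(hprops ω hω).2, pow_succ, mul_comm]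
    _ = ∑ p ∈ (fibW m k).image g, y * y ^ visits (m + 3) p.1 := by rw [Finset.sum_image hinj]
    _ ≤ ∑ p ∈ F ×ˢ (Finset.univ : Finset Bool), y * y ^ visits (m + 3) p.1 := by
        refine Finset.sum_le_sum_of_subset_of_nonneg (fun p hp => ?_) fun _ _ _ => mul_nonneg hy (pow_nonneg hy _)
        obtain ⟨ω, hω, rfl⟩ := Finset.mem_image.1 hp
        exact Finset.mem_product.2 ⟨(hprops ω hω).1, Finset.mem_univ _⟩
    _ = 2 * y * ∑ ξ ∈ F, y ^ visits (m + 3) ξ := by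
        rw [Finset.sum_product, Finset.mul_sum]
        refine Finset.sum_congr rfl fun ξ _ => ?_
        simp only [Finset.sum_const, Finset.card_univ, Fintype.card_bool, nsmul_eq_mul]
        push_cast
        ring
    _ ≤ 2 * y * (X3w k y * #(saws (m + 3 - k))) :=
        mul_le_mul_of_nonneg_left (sum_fibre_lastV_le_X3 (n := m + 3) hy (by omega)) (by positivity)

set_option maxHeartbeats 400000 in
open Classical in
/-- **The straight fibre, restricted to three-step-extendable arches,** weighs at most `y · X³_{m+2}(y)`: the prefix `ω|[0,m+2]` is
three-step extendable with witnesses `ω (m+3)`, `ω (m+4)` and the first site of `ω`'s own continuation. [cite: BeatonBousquetMelouDeGierDuminilCopinGuttmann2014, §3.1 (arXiv v5 p. 9: walks sticking to the surface); EntingJensen2009, §7.4.2, Fig. 7.10] -/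
theorem sum_fibW_self_le_X3 (m : ℕ) (hy : 0 ≤ y) :
    ∑ ω ∈ (fibW m (m + 2)).filter (Ext3 (m + 4)), y ^ visits (m + 4) ω ≤ y * X3w (m + 2) y := by
  set S := (fibW m (m + 2)).filter (Ext3 (m + 4)) with hS
  have hmemS : ∀ ω ∈ S, ω ∈ fibW m (m + 2) ∧ Ext3 (m + 4) ω := fun ω hω => Finset.mem_filter.1 hω
  set g : (ℕ → Site 2) → (ℕ → Site 2) := fun ω => Zd.prefixWalk (m + 2) ω with hg
  have hcoord : ∀ ω ∈ fibW m (m + 2), ω (m + 3) 0 = 2 * ω (m + 2) 0 - ω (m + 1) 0 ∧ ω (m + 3) 1 = 0 ∧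
      ω (m + 4) 0 = 2 * ω (m + 3) 0 - ω (m + 2) 0 ∧ ω (m + 4) 1 = 0 := by
    intro ω hω
    obtain ⟨hωh, hm, hend, -, -, hkY, -, -⟩ := fibW_anatomy hω
    obtain ⟨hωs, -⟩ := mem_hpw.1 hωh
    obtain ⟨-, -, -, hinj⟩ := mem_saws_iff.1 hωs
    have hωa : ω ∈ archs (m + 3 + 1) := by
      rw [show m + 3 + 1 = m + 4 by omega]; exact (Finset.mem_filter.1 hω).1
    obtain ⟨hY3, hX4⟩ := arch_last_step hωa
    obtain ⟨-, hX3⟩ := surface_next_step hωh (i := m + 2) (by omega) (by omega) hkY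
    obtain ⟨hY1, hX1⟩ := surface_prev_step hωh (i := m + 1) (by omega) (by omega)
      (by rw [show m + 1 + 1 = m + 2 by omega]; exact hkY)
    rw [show m + 2 + 1 = m + 3 by omega] at hX3
    rw [show m + 1 + 1 = m + 2 by omega] at hX1
    rw [show m + 3 + 1 = m + 4 by omega] at hX4
    have hne13 : ω (m + 1) ≠ ω (m + 3) := fun h => by
      have := hinj (show m + 1 ∈ {j | j ≤ m + 4} by simp only [Set.mem_setOf_eq]; omega)
        (show m + 3 ∈ {j | j ≤ m + 4} by simp only [Set.mem_setOf_eq]; omega) h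
      omega
    have hne24 : ω (m + 2) ≠ ω (m + 4) := fun h => by
      have := hinj (show m + 2 ∈ {j | j ≤ m + 4} by simp only [Set.mem_setOf_eq]; omega)
        (show m + 4 ∈ {j | j ≤ m + 4} by simp only [Set.mem_setOf_eq]; exact le_rfl) h
      omega
    have hne13' : ω (m + 1) 0 ≠ ω (m + 3) 0 := fun h => hne13 ((site_two_eq_iff _ _).2 ⟨h, by rw [hY1, hY3]⟩)
    have hne24' : ω (m + 2) 0 ≠ ω (m + 4) 0 := fun h => hne24 ((site_two_eq_iff _ _).2 ⟨h, by rw [hkY, hend]⟩)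
    refine ⟨by omega, hY3, by omega, hend⟩
  have hprops : ∀ ω ∈ S, g ω ∈ archs3 (m + 2) ∧ visits (m + 4) ω = visits (m + 2) (g ω) + 1 := by
    intro ω hωS
    obtain ⟨hω, hE⟩ := hmemS ω hωS
    obtain ⟨hωh, hm, hend, -, -, hkY, -, -⟩ := fibW_anatomy hω
    obtain ⟨-, hY3, -, -⟩ := hcoord ω hω
    obtain ⟨hpa, hpv⟩ := prefixWalk_mem_archs hωh (show m + 2 ≤ m + 4 by omega) (by omega) hkY
    obtain ⟨hωs, hH⟩ := mem_hpw.1 hωh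
    obtain ⟨-, -, hbw, hinj⟩ := mem_saws_iff.1 hωs
    have hv : ∀ i ≤ m + 2, g ω i = ω i := fun i hi => by simp [hg, Zd.prefixWalk, min_eq_left hi]
    have hne : ∀ a b : ℕ, a ≤ m + 4 → b ≤ m + 4 → a ≠ b → ω a ≠ ω b := fun a b ha hb hab h =>
      hab (hinj (show a ∈ {j | j ≤ m + 4} by simp only [Set.mem_setOf_eq]; exact ha)
        (show b ∈ {j | j ≤ m + 4} by simp only [Set.mem_setOf_eq]; exact hb) h)
    obtain ⟨z₁, z₂, z₃, hz1, -, -, hz1', -, -, -, hfresh⟩ := hE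
    refine ⟨mem_archs3.2 ⟨hpa, ω (m + 3), ω (m + 4), z₁, ?_, ?_, hz1, hH _ (by omega), le_of_eq hend, hz1', ?_, fun i hi => ⟨?_, ?_, ?_⟩⟩, ?_⟩
    · rw [hv (m + 2) le_rfl]; exact hbw (m + 2) (by omega)
    · have := hbw (m + 3) (by omega); rwa [show m + 3 + 1 = m + 4 by omega] at this
    · exact (hfresh (m + 3) (by omega)).1
    · rw [hv i hi]; exact hne _ _ (by omega) (by omega) (by omega)
    · rw [hv i hi]; exact hne _ _ (by omega) (by omega) (by omega)
    · rw [hv i hi]; exact (hfresh i (by omega)).1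
    rw [show m + 4 = m + 3 + 1 by omega, visits_succ, show m + 3 = m + 2 + 1 by omega, visits_succ, hpv]
    have h3 : ¬ ((m + 2 + 1) % 2 = 0 ∧ ω (m + 2 + 1) 1 = 0) := fun h => by omega
    have h4 : (m + 2 + 1 + 1) % 2 = 0 ∧ ω (m + 2 + 1 + 1) 1 = 0 :=
      ⟨by omega, by rw [show m + 2 + 1 + 1 = m + 4 by omega]; exact hend⟩
    rw [if_neg h3, if_pos h4]
  have hinj : Set.InjOn g ↑S := by
    intro ω hωS ω' hωS' h
    rw [Finset.mem_coe] at hωS hωS'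
    have hω := (hmemS ω hωS).1
    have hω' := (hmemS ω' hωS').1
    have hc := hcoord ω hω
    have hc' := hcoord ω' hω'
    have hωs := hpw_subset (fibW_anatomy hω).1
    have hωs' := hpw_subset (fibW_anatomy hω').1
    have hagree : ∀ i ≤ m + 2, ω i = ω' i := fun i hi => by
      have := congrFun h i
      simpa [hg, Zd.prefixWalk, min_eq_left hi] using this
    have e1 : ω (m + 1) 0 = ω' (m + 1) 0 := by rw [hagree (m + 1) (by omega)]
    have e2 : ω (m + 2) 0 = ω' (m + 2) 0 := by rw [hagree (m + 2) le_rfl]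
    refine Arm.eq_of_agree hωs hωs' fun i hi => ?_
    rcases Nat.lt_or_ge i (m + 3) with hi' | hi'
    · exact hagree i (by omega)
    · rw [site_two_eq_iff]
      obtain ⟨a0, a1, b0, b1⟩ := hc
      obtain ⟨a0', a1', b0', b1'⟩ := hc'
      have hcase : i = m + 3 ∨ i = m + 4 := by omega
      rcases hcase with rfl | rfl
      · exact ⟨by rw [a0, a0', e1, e2], by rw [a1, a1']⟩
      · exact ⟨by rw [b0, b0', a0, a0', e1, e2], by rw [b1, b1']⟩
  calc ∑ ω ∈ S, y ^ visits (m + 4) ω = ∑ ω ∈ S, y * y ^ visits (m + 2) (g ω) :=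
        Finset.sum_congr rfl fun ω hω => by rw [(hprops ω hω).2, pow_succ, mul_comm]
    _ = y * ∑ ξ ∈ S.image g, y ^ visits (m + 2) ξ := by rw [Finset.mul_sum, Finset.sum_image hinj]
    _ ≤ y * X3w (m + 2) y := by
        refine mul_le_mul_of_nonneg_left ?_ hy
        rw [X3w]
        refine Finset.sum_le_sum_of_subset_of_nonneg (fun ξ hξ => ?_) fun _ _ _ => pow_nonneg hy _
        obtain ⟨ω, hω, rfl⟩ := Finset.mem_image.1 hξ
        exact (hprops ω hω).1

/-! ### §4  The dip fibre (excursion length six) under three-step extendability -/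

open Classical in
/-- **Anatomy of the dip fibre under extendability.**  Let `ω ∈ fibW (j+4) (j+2)` (an arch of length `j+8` whose last surface visit before
the end is at time `j+2 ≥ 2`) be extendable along the row.  With `x = X_{j+2}` and `x' = X_{j+1}` (the previous row vertex, so `σ = x − x' = ±1`
is the direction of travel) the last six steps are FORCED: `(x+σ,0) (x+σ,−1) (x+2σ,−1) (x+3σ,−1) (x+3σ,0) (x+4σ,0)` — the forward dip
around one hexagon.  (Going back under the start returns to `ω (j+1)`; the «hook» ending `(x+3σ,0) → (x+2σ,0)` is a dead end, excluded by
extendability; deeper excursions are too long.) [cite: EntingJensen2009, §7.4.2, Fig. 7.10 (brickwork form of the honeycomb lattice); BeatonBousquetMelouDeGierDuminilCopinGuttmann2014, §3.1 (arXiv v5 p. 9: walks sticking to the surface)] -/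
theorem dip_coords3 {j : ℕ} (hω : ω ∈ fibW (j + 4) (j + 2)) (hE : Ext3 (j + 8) ω) :
    ω (j + 1) 1 = 0 ∧
    (ω (j + 3) 0 = 2 * ω (j + 2) 0 - ω (j + 1) 0 ∧ ω (j + 3) 1 = 0) ∧
    (ω (j + 4) 0 = 2 * ω (j + 2) 0 - ω (j + 1) 0 ∧ ω (j + 4) 1 = -1) ∧
    (ω (j + 5) 0 = 3 * ω (j + 2) 0 - 2 * ω (j + 1) 0 ∧ ω (j + 5) 1 = -1) ∧
    (ω (j + 6) 0 = 4 * ω (j + 2) 0 - 3 * ω (j + 1) 0 ∧ ω (j + 6) 1 = -1) ∧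
    (ω (j + 7) 0 = 4 * ω (j + 2) 0 - 3 * ω (j + 1) 0 ∧ ω (j + 7) 1 = 0) ∧
    (ω (j + 8) 0 = 5 * ω (j + 2) 0 - 4 * ω (j + 1) 0 ∧ ω (j + 8) 1 = 0) := by
  have hω' : ω ∈ fibW (j + 4) (j + 2) := hω
  obtain ⟨hωh, -, hend, -, hk2, hkY, hno, -⟩ := fibW_anatomy hω'
  rw [show j + 4 + 4 = j + 8 by omega] at hωh hend
  obtain ⟨hωs, hH⟩ := mem_hpw.1 hωh
  obtain ⟨-, -, hbw, hinj⟩ := mem_saws_iff.1 hωs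
  have hne : ∀ a b : ℕ, a ≤ j + 8 → b ≤ j + 8 → a ≠ b → ¬ (ω a 0 = ω b 0 ∧ ω a 1 = ω b 1) := by
    intro a b ha hb hab h
    have := hinj (show a ∈ {i | i ≤ j + 8} by simp only [Set.mem_setOf_eq]; exact ha)
      (show b ∈ {i | i ≤ j + 8} by simp only [Set.mem_setOf_eq]; exact hb) ((site_two_eq_iff _ _).2 h)
    exact hab this
  -- the previous row vertex and the next one
  obtain ⟨hY1, hX2⟩ := surface_prev_step hωh (i := j + 1) (by omega) (by omega)
    (by rw [show j + 1 + 1 = j + 2 by omega]; exact hkY)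
  rw [show j + 1 + 1 = j + 2 by omega] at hX2
  obtain ⟨hY3, hX3⟩ := surface_next_step hωh (i := j + 2) (by omega) hk2 hkY
  rw [show j + 2 + 1 = j + 3 by omega] at hY3 hX3
  have h13 := hne (j + 3) (j + 1) (by omega) (by omega) (by omega)
  have hX3' : ω (j + 3) 0 = 2 * ω (j + 2) 0 - ω (j + 1) 0 := by omega
  -- time `j+4`: down
  have hn4 : ¬ (ω (j + 4) 1 = 0) := fun h => hno (j + 4) (by omega) (by omega) ⟨by omega, h⟩
  have s4 := Arm.step_cases (hbw (j + 3) (by omega))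
  rw [show j + 3 + 1 = j + 4 by omega] at s4
  have hH4 := hH (j + 4) (by omega)
  have hX4 : ω (j + 4) 0 = ω (j + 3) 0 := by omega
  have hY4 : ω (j + 4) 1 = -1 := by omega
  have hP4 : (ω (j + 4) 0 + ω (j + 4) 1) % 2 = 0 := by omega
  -- time `j+5`: along the lower row
  have s5 := Arm.step_cases (hbw (j + 4) (by omega))
  rw [show j + 4 + 1 = j + 5 by omega] at s5
  have h53 := hne (j + 5) (j + 3) (by omega) (by omega) (by omega)
  have hY5 : ω (j + 5) 1 = -1 := by omega
  have hX5 : ω (j + 5) 0 = ω (j + 4) 0 + 1 ∨ ω (j + 4) 0 = ω (j + 5) 0 + 1 := by omega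
  -- time `j+7` is on the row (vertex before the end of an arch), so time `j+6` is at height `-1`
  have hωa : ω ∈ archs (j + 7 + 1) := by
    rw [show j + 7 + 1 = j + 4 + 4 by omega]; exact (Finset.mem_filter.1 hω').1
  obtain ⟨hY7, hX8⟩ := arch_last_step hωa
  rw [show j + 7 + 1 = j + 8 by omega] at hX8
  have hn6 : ¬ (ω (j + 6) 1 = 0) := fun h => hno (j + 6) (by omega) (by omega) ⟨by omega, h⟩
  have s6 := Arm.step_cases (hbw (j + 5) (by omega))
  rw [show j + 5 + 1 = j + 6 by omega] at s6
  have s7 := Arm.step_cases (hbw (j + 6) (by omega))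
  rw [show j + 6 + 1 = j + 7 by omega] at s7
  have hY6 : ω (j + 6) 1 = -1 := by omega
  have hX6 : ω (j + 6) 0 = ω (j + 5) 0 + 1 ∨ ω (j + 5) 0 = ω (j + 6) 0 + 1 := by omega
  have hX7 : ω (j + 7) 0 = ω (j + 6) 0 := by omega
  have hP6 : (ω (j + 6) 0 + ω (j + 6) 1) % 2 = 0 := by omega
  -- directions: not back under the start (that returns to `ω (j+1)`), not onto `ω (j+4)`
  have h64 := hne (j + 6) (j + 4) (by omega) (by omega) (by omega)
  have h71 := hne (j + 7) (j + 1) (by omega) (by omega) (by omega)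
  have hX5' : ω (j + 5) 0 = 3 * ω (j + 2) 0 - 2 * ω (j + 1) 0 := by omega
  have hX6' : ω (j + 6) 0 = 4 * ω (j + 2) 0 - 3 * ω (j + 1) 0 := by omega
  -- the end: the hook `(x+2σ, 0)` is a dead end, excluded by extendability
  have hX8' : ω (j + 8) 0 = 5 * ω (j + 2) 0 - 4 * ω (j + 1) 0 := by
    by_contra h8
    -- then the end is the hook `(x+2σ, 0)`, whose two row-neighbours `ω (j+3)`, `ω (j+7)` are visited
    have hhook : ω (j + 8) 0 = 3 * ω (j + 2) 0 - 2 * ω (j + 1) 0 := by omega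
    obtain ⟨z, hz, hz1, hzne⟩ := hE.exists_fresh
    rw [brickWallGraph_adj_coord] at hz
    -- the end `(x+2σ,0)` has even parity (time `j+8`): no downward bond, and `z` lies in the half-plane, so `z` is a row-neighbour
    have hpar := parity_apply hωs (i := j + 8) le_rfl
    rw [hend] at hpar
    have hz10 : z 1 = 0 := by omega
    have hz0 : z 0 = ω (j + 3) 0 ∨ z 0 = ω (j + 7) 0 := by omega
    rcases hz0 with hz0 | hz0
    · exact hzne (j + 3) (by omega) ((site_two_eq_iff _ _).2 ⟨hz0.symm, by rw [hY3, hz10]⟩)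
    · exact hzne (j + 7) (by omega) ((site_two_eq_iff _ _).2 ⟨hz0.symm, by rw [hY7, hz10]⟩)
  exact ⟨hY1, ⟨hX3', hY3⟩, ⟨by omega, hY4⟩, ⟨hX5', hY5⟩, ⟨hX6', hY6⟩, ⟨by omega, hY7⟩, ⟨hX8', hend⟩⟩

open Classical in
/-- **The dip fibre injects into the extendable arches six steps shorter, at the price of one visit**:
`Σ_{ω ∈ fibW (j+4) (j+2), 3-extendable} y^{visits} ≤ y · X³_{j+2}(y)` (`y ≥ 0`). [cite: HammersleyTorrieWhittington1982, §2 (as summarised by Beaton 2014 arXiv v3 p. 11; locator provisional); EntingJensen2009, §7.4.2, Fig. 7.10] -/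
theorem sum_fibW_dip_le_X3 (j : ℕ) (hy : 0 ≤ y) :
    ∑ ω ∈ (fibW (j + 4) (j + 2)).filter (Ext3 (j + 8)), y ^ visits (j + 8) ω ≤ y * X3w (j + 2) y := by
  set D := (fibW (j + 4) (j + 2)).filter (Ext3 (j + 8)) with hD
  set g : (ℕ → Site 2) → (ℕ → Site 2) := fun ω => Zd.prefixWalk (j + 2) ω with hg
  have hmemD : ∀ ω ∈ D, ω ∈ fibW (j + 4) (j + 2) ∧ Ext3 (j + 8) ω := fun ω hω => Finset.mem_filter.1 hω
  have hprops : ∀ ω ∈ D, g ω ∈ archs3 (j + 2) ∧ visits (j + 8) ω = visits (j + 2) (g ω) + 1 := by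
    intro ω hω
    obtain ⟨hωf, -⟩ := hmemD ω hω
    obtain ⟨hωh, -, hend, -, hk2, hkY, hno, -⟩ := fibW_anatomy hωf
    rw [show j + 4 + 4 = j + 8 by omega] at hωh hend
    obtain ⟨hpa, hpv⟩ := prefixWalk_mem_archs3 hωh (show j + 2 + 3 ≤ j + 8 by omega) hk2 hkY
    refine ⟨hpa, ?_⟩
    have e := visits_add_eq_left (k := j + 2) (b := 5) (ζ := ω) (fun i hi1 hi5 h => by
      have hi : i = 2 ∨ i = 4 := by omega
      rcases hi with rfl | rfl
      · exact hno (j + 4) (by omega) (by omega) ⟨by omega, by rw [show j + 4 = j + 2 + 2 by omega]; exact h.2⟩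
      · exact hno (j + 6) (by omega) (by omega) ⟨by omega, by rw [show j + 6 = j + 2 + 4 by omega]; exact h.2⟩)
    rw [show j + 8 = j + 2 + 5 + 1 by omega, visits_succ, e, hpv]
    have h8 : (j + 2 + 5 + 1) % 2 = 0 ∧ ω (j + 2 + 5 + 1) 1 = 0 :=
      ⟨by omega, by rw [show j + 2 + 5 + 1 = j + 8 by omega]; exact hend⟩
    rw [if_pos h8]
  have hinj : Set.InjOn g ↑D := by
    intro ω hω ω' hω' h
    rw [Finset.mem_coe] at hω hω'
    obtain ⟨hωf, hE⟩ := hmemD ω hω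
    obtain ⟨hωf', hE'⟩ := hmemD ω' hω'
    have hc := dip_coords3 hωf hE
    have hc' := dip_coords3 hωf' hE'
    have hωs : ω ∈ saws (j + 8) := by
      have := (fibW_anatomy hωf).1; rw [show j + 4 + 4 = j + 8 by omega] at this; exact hpw_subset this
    have hωs' : ω' ∈ saws (j + 8) := by
      have := (fibW_anatomy hωf').1; rw [show j + 4 + 4 = j + 8 by omega] at this; exact hpw_subset this
    have hagree : ∀ i ≤ j + 2, ω i = ω' i := fun i hi => by
      have := congrFun h i
      simpa [hg, Zd.prefixWalk, min_eq_left hi] using this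
    have e1 : ω (j + 1) 0 = ω' (j + 1) 0 := by rw [hagree (j + 1) (by omega)]
    have e2 : ω (j + 2) 0 = ω' (j + 2) 0 := by rw [hagree (j + 2) le_rfl]
    obtain ⟨-, ⟨a0, a1⟩, ⟨b0, b1⟩, ⟨c0, c1⟩, ⟨d0, d1⟩, ⟨f0, f1⟩, ⟨g0, g1⟩⟩ := hc
    obtain ⟨-, ⟨a0', a1'⟩, ⟨b0', b1'⟩, ⟨c0', c1'⟩, ⟨d0', d1'⟩, ⟨f0', f1'⟩, ⟨g0', g1'⟩⟩ := hc'
    refine Arm.eq_of_agree hωs hωs' fun i hi => ?_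
    rcases Nat.lt_or_ge i (j + 3) with hi' | hi'
    · exact hagree i (by omega)
    · rw [site_two_eq_iff]
      have hcase : i = j + 3 ∨ i = j + 4 ∨ i = j + 5 ∨ i = j + 6 ∨ i = j + 7 ∨ i = j + 8 := by omega
      rcases hcase with rfl | rfl | rfl | rfl | rfl | rfl
      · exact ⟨by rw [a0, a0', e1, e2], by rw [a1, a1']⟩
      · exact ⟨by rw [b0, b0', e1, e2], by rw [b1, b1']⟩
      · exact ⟨by rw [c0, c0', e1, e2], by rw [c1, c1']⟩
      · exact ⟨by rw [d0, d0', e1, e2], by rw [d1, d1']⟩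
      · exact ⟨by rw [f0, f0', e1, e2], by rw [f1, f1']⟩
      · exact ⟨by rw [g0, g0', e1, e2], by rw [g1, g1']⟩
  calc ∑ ω ∈ D, y ^ visits (j + 8) ω = ∑ ω ∈ D, y * y ^ visits (j + 2) (g ω) :=
        Finset.sum_congr rfl fun ω hω => by rw [(hprops ω hω).2, pow_succ, mul_comm]
    _ = y * ∑ ξ ∈ D.image g, y ^ visits (j + 2) ξ := by rw [Finset.mul_sum, Finset.sum_image hinj]
    _ ≤ y * X3w (j + 2) y := by
        refine mul_le_mul_of_nonneg_left ?_ hy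
        rw [X3w]
        refine Finset.sum_le_sum_of_subset_of_nonneg (fun ξ hξ => ?_) fun _ _ _ => pow_nonneg hy _
        obtain ⟨ω, hω, rfl⟩ := Finset.mem_image.1 hξ
        exact (hprops ω hω).1


/-! ### §5  The flat fibre (excursion length eight): a THREE-STEP-EXTENDABLE arch ending eight steps after its last surface visit ends with
the flat excursion `(x+σ,0) (x+σ,−1) (x+2σ,−1) (x+3σ,−1) (x+4σ,−1) (x+5σ,−1) (x+5σ,0) (x+6σ,0)` -/

set_option maxHeartbeats 400000 in
open Classical in
/-- **The flat fibre, first half** (`j ≥ 1`): for `ω ∈ fibW (j+6) (j+2)` (last surface visit `ω (j+2) = (x,0)` eight steps before the end;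
`x' = X_{j+1}`, `σ = x − x'`) the four steps after the visit are `(x+σ,0) (x+σ,−1) (x+2σ,−1) (x+3σ,−1)`: the walk cannot turn back under
its start — it would meet `ω j = (x−σ,−1)`, or, if `ω j = (x−2σ,0)` is a surface vertex, be forced along `(x−2σ,−1) (x−3σ,−1)` to
resurface at `ω (j−1) = (x−3σ,0)` — and cannot drop to depth `−2` (no resurfacing by time `j+9`).  No extendability is used here.
[cite: EntingJensen2009, §7.4.2, Fig. 7.10 (brickwork form of the honeycomb lattice)] -/
theorem flat8_head {j : ℕ} (hj : 1 ≤ j) (hω : ω ∈ fibW (j + 6) (j + 2)) :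
    ω (j + 1) 1 = 0 ∧ (ω (j + 2) 0 = ω (j + 1) 0 + 1 ∨ ω (j + 1) 0 = ω (j + 2) 0 + 1) ∧ ω (j + 2) 0 % 2 = 0 ∧
    (ω (j + 3) 0 = 2 * ω (j + 2) 0 - ω (j + 1) 0 ∧ ω (j + 3) 1 = 0) ∧
    (ω (j + 4) 0 = 2 * ω (j + 2) 0 - ω (j + 1) 0 ∧ ω (j + 4) 1 = -1) ∧
    (ω (j + 5) 0 = 3 * ω (j + 2) 0 - 2 * ω (j + 1) 0 ∧ ω (j + 5) 1 = -1) ∧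
    (ω (j + 6) 0 = 4 * ω (j + 2) 0 - 3 * ω (j + 1) 0 ∧ ω (j + 6) 1 = -1) := by
  have hω' : ω ∈ fibW (j + 6) (j + 2) := hω
  obtain ⟨hωh, -, hend, -, hk2, hkY, hno, -⟩ := fibW_anatomy hω'
  rw [show j + 6 + 4 = j + 10 by omega] at hωh hend
  obtain ⟨hωs, hH⟩ := mem_hpw.1 hωh
  obtain ⟨-, -, hbw, hinj⟩ := mem_saws_iff.1 hωs
  have hne : ∀ a b : ℕ, a ≤ j + 10 → b ≤ j + 10 → a ≠ b → ¬ (ω a 0 = ω b 0 ∧ ω a 1 = ω b 1) := by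
    intro a b ha hb hab h
    have := hinj (show a ∈ {i | i ≤ j + 10} by simp only [Set.mem_setOf_eq]; exact ha)
      (show b ∈ {i | i ≤ j + 10} by simp only [Set.mem_setOf_eq]; exact hb) ((site_two_eq_iff _ _).2 h)
    exact hab this
  have hparx : (ω (j + 2) 0 + ω (j + 2) 1) % 2 = ((j + 2 : ℕ) : ℤ) % 2 := parity_apply hωs (i := j + 2) (by omega)
  have hxe : ω (j + 2) 0 % 2 = 0 := by rw [hkY, add_zero] at hparx; push_cast at hparx; omega
  obtain ⟨hY1, hX2⟩ := surface_prev_step hωh (i := j + 1) (by omega) (by omega)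
    (by rw [show j + 1 + 1 = j + 2 by omega]; exact hkY)
  rw [show j + 1 + 1 = j + 2 by omega] at hX2
  -- `ω j`: either the surface vertex `(x−2σ,0)` (then `ω (j−1) = (x−3σ,0)`) or `(x−σ,−1)`
  have h_prev : (ω j 1 = 0 ∧ ω j 0 = 2 * ω (j + 1) 0 - ω (j + 2) 0 ∧ ω (j - 1) 1 = 0 ∧
      ω (j - 1) 0 = 3 * ω (j + 1) 0 - 2 * ω (j + 2) 0) ∨ (ω j 1 = -1 ∧ ω j 0 = ω (j + 1) 0) := by
    have sj := Arm.step_cases (hbw j (by omega))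
    have hHj := hH j (by omega)
    have h02 := hne j (j + 2) (by omega) (by omega) (by omega)
    by_cases hYj : ω j 1 = 0
    · left
      have hev : j % 2 = 0 := by omega
      obtain ⟨hY0, hX0⟩ := surface_prev_step hωh (i := j - 1) (by omega) (by rw [show j - 1 + 1 = j by omega]; exact hev)
        (by rw [show j - 1 + 1 = j by omega]; exact hYj)
      rw [show j - 1 + 1 = j by omega] at hX0
      have hm11 := hne (j - 1) (j + 1) (by omega) (by omega) (by omega)
      have hXj : ω j 0 = 2 * ω (j + 1) 0 - ω (j + 2) 0 := by clear hX0 hm11; omega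
      refine ⟨hYj, hXj, hY0, ?_⟩
      clear sj h02
      omega
    · right
      constructor <;> omega
  -- forward: `ω (j+3) = (x+σ, 0)`
  obtain ⟨hY3, hX3⟩ := surface_next_step hωh (i := j + 2) (by omega) hk2 hkY
  rw [show j + 2 + 1 = j + 3 by omega] at hY3 hX3
  have h31 := hne (j + 3) (j + 1) (by omega) (by omega) (by omega)
  have hX3' : ω (j + 3) 0 = 2 * ω (j + 2) 0 - ω (j + 1) 0 := by clear h_prev; omega
  clear hX3 h31
  -- `ω (j+4) = (x+σ, −1)`
  have hn4 : ¬ (ω (j + 4) 1 = 0) := fun h => hno (j + 4) (by omega) (by omega) ⟨by omega, h⟩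
  have s4 := Arm.step_cases (hbw (j + 3) (by omega))
  rw [show j + 3 + 1 = j + 4 by omega] at s4
  have hH4 := hH (j + 4) (by omega)
  have hXY4 : ω (j + 4) 0 = ω (j + 3) 0 ∧ ω (j + 4) 1 = -1 := by clear h_prev; constructor <;> omega
  obtain ⟨hX4, hY4⟩ := hXY4
  clear s4 hn4 hH4
  -- `ω (j+5)`: along depth `−1`, `X ∈ {x, x+2σ}`
  have s5 := Arm.step_cases (hbw (j + 4) (by omega))
  rw [show j + 4 + 1 = j + 5 by omega] at s5
  have h53 := hne (j + 5) (j + 3) (by omega) (by omega) (by omega)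
  have hY5 : ω (j + 5) 1 = -1 := by clear h_prev; omega
  have hX5 : ω (j + 5) 0 = ω (j + 4) 0 + 1 ∨ ω (j + 4) 0 = ω (j + 5) 0 + 1 := by clear h_prev; omega
  clear s5 h53
  -- `ω (j+6)`: still at depth `−1` (a drop to `−2` cannot resurface by `j+9`), `X = X_{j+5} ± 1`
  have s6 := Arm.step_cases (hbw (j + 5) (by omega))
  rw [show j + 5 + 1 = j + 6 by omega] at s6
  have s7 := Arm.step_cases (hbw (j + 6) (by omega))
  rw [show j + 6 + 1 = j + 7 by omega] at s7
  have s8 := Arm.step_cases (hbw (j + 7) (by omega))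
  rw [show j + 7 + 1 = j + 8 by omega] at s8
  have s9 := Arm.step_cases (hbw (j + 8) (by omega))
  rw [show j + 8 + 1 = j + 9 by omega] at s9
  obtain ⟨hY9, -⟩ : ω (j + 9) 1 = 0 ∧ (ω (j + 9 + 1) 0 = ω (j + 9) 0 + 1 ∨ ω (j + 9) 0 = ω (j + 9 + 1) 0 + 1) :=
    arch_last_step (n := j + 9) (by rw [show j + 9 + 1 = j + 6 + 4 by omega]; exact (Finset.mem_filter.1 hω').1)
  have h75 := hne (j + 7) (j + 5) (by omega) (by omega) (by omega)
  have hn6 : ¬ (ω (j + 6) 1 = 0) := fun h => hno (j + 6) (by omega) (by omega) ⟨by omega, h⟩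
  have hY6 : ω (j + 6) 1 = -1 := by
    clear h_prev hX2 hX3' hX5 hX4 hxe
    omega
  have hX6 : ω (j + 6) 0 = ω (j + 5) 0 + 1 ∨ ω (j + 5) 0 = ω (j + 6) 0 + 1 := by
    clear h_prev s7 s8 s9 h75 hX2 hxe
    omega
  have h64 := hne (j + 6) (j + 4) (by omega) (by omega) (by omega)
  clear s6
  -- exclude the backward branch `X_{j+5} = x`
  have hfwd : ω (j + 5) 0 = 3 * ω (j + 2) 0 - 2 * ω (j + 1) 0 := by
    by_contra hb
    have hX5' : ω (j + 5) 0 = ω (j + 2) 0 := by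
      clear h_prev s7 s8 s9 h75 hX6 h64 hxe
      omega
    have hX6' : ω (j + 6) 0 = ω (j + 1) 0 := by
      clear h_prev s7 s8 s9 h75 hxe hb
      omega
    clear hX5 hX6 h64 hb
    have h60 := hne (j + 6) j (by omega) (by omega) (by omega)
    rcases h_prev with ⟨hYj, hXj, hY0, hX0⟩ | ⟨hYj, hXj⟩
    · -- `ω j` on the row: `ω (j+7) = (x−2σ,−1)`, `ω (j+8) = (x−3σ,−1)`, `ω (j+9) = (x−3σ,0) = ω (j−1)`
      have h71 := hne (j + 7) (j + 1) (by omega) (by omega) (by omega)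
      have hXY7 : ω (j + 7) 0 = 2 * ω (j + 1) 0 - ω (j + 2) 0 ∧ ω (j + 7) 1 = -1 := by
        clear s8 s9 hY0 hX0 h60 hYj hXj
        constructor <;> omega
      obtain ⟨hX7, hY7⟩ := hXY7
      clear s7 h71 h75
      have h86 := hne (j + 8) (j + 6) (by omega) (by omega) (by omega)
      have h80 := hne (j + 8) j (by omega) (by omega) (by omega)
      have hn8 : ¬ (ω (j + 8) 1 = 0) := fun h => hno (j + 8) (by omega) (by omega) ⟨by omega, h⟩
      have hXY8 : ω (j + 8) 0 = 3 * ω (j + 1) 0 - 2 * ω (j + 2) 0 ∧ ω (j + 8) 1 = -1 := by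
        clear hY0 hX0 h60
        constructor <;> omega
      obtain ⟨hX8, hY8⟩ := hXY8
      clear s8 h86 h80 hn8
      have h9m := hne (j + 9) (j - 1) (by omega) (by omega) (by omega)
      omega
    · exact h60 ⟨by omega, by omega⟩
  have hX6' : ω (j + 6) 0 = 4 * ω (j + 2) 0 - 3 * ω (j + 1) 0 := by
    clear s7 s8 s9 h_prev h75 hxe
    omega
  exact ⟨hY1, hX2, hxe, ⟨hX3', hY3⟩, ⟨by omega, hY4⟩, ⟨hfwd, hY5⟩, ⟨hX6', hY6⟩⟩

set_option maxHeartbeats 400000 in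
open Classical in
/-- **The flat fibre, second half, under three-step extendability**: after `(x+3σ,−1)` at time `j+6` the walk is forced along `(x+4σ,−1)
(x+5σ,−1) (x+5σ,0)` (surfacing at the odd vertex `(x+3σ,0)` would make time `j+8` a surface visit; `(x+4σ,−1)` has no up-bond; a drop
cannot resurface by `j+9`) and ends at `(x+6σ,0)` — the «late hook» ending `(x+5σ,0) → (x+4σ,0)` admits exactly the two fresh forced steps
`(x+3σ,0) (x+2σ,0)` and no third, so it is not three-step extendable. [cite: EntingJensen2009, §7.4.2, Fig. 7.10 (brickwork form of the honeycomb lattice); BeatonBousquetMelouDeGierDuminilCopinGuttmann2014, §3.1 (arXiv v5 p. 9)] -/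
theorem flat8_coords {j : ℕ} (hj : 1 ≤ j) (hω : ω ∈ fibW (j + 6) (j + 2)) (hE : Ext3 (j + 10) ω) :
    ω (j + 1) 1 = 0 ∧
    (ω (j + 3) 0 = 2 * ω (j + 2) 0 - ω (j + 1) 0 ∧ ω (j + 3) 1 = 0) ∧
    (ω (j + 4) 0 = 2 * ω (j + 2) 0 - ω (j + 1) 0 ∧ ω (j + 4) 1 = -1) ∧
    (ω (j + 5) 0 = 3 * ω (j + 2) 0 - 2 * ω (j + 1) 0 ∧ ω (j + 5) 1 = -1) ∧
    (ω (j + 6) 0 = 4 * ω (j + 2) 0 - 3 * ω (j + 1) 0 ∧ ω (j + 6) 1 = -1) ∧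
    (ω (j + 7) 0 = 5 * ω (j + 2) 0 - 4 * ω (j + 1) 0 ∧ ω (j + 7) 1 = -1) ∧
    (ω (j + 8) 0 = 6 * ω (j + 2) 0 - 5 * ω (j + 1) 0 ∧ ω (j + 8) 1 = -1) ∧
    (ω (j + 9) 0 = 6 * ω (j + 2) 0 - 5 * ω (j + 1) 0 ∧ ω (j + 9) 1 = 0) ∧
    (ω (j + 10) 0 = 7 * ω (j + 2) 0 - 6 * ω (j + 1) 0 ∧ ω (j + 10) 1 = 0) := by
  obtain ⟨hY1, hX2, hxe, ⟨hX3, hY3⟩, ⟨hX4, hY4⟩, ⟨hX5, hY5⟩, ⟨hX6, hY6⟩⟩ := flat8_head hj hω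
  have hω' : ω ∈ fibW (j + 6) (j + 2) := hω
  obtain ⟨hωh, -, hend, -, hk2, hkY, hno, -⟩ := fibW_anatomy hω'
  rw [show j + 6 + 4 = j + 10 by omega] at hωh hend
  obtain ⟨hωs, hH⟩ := mem_hpw.1 hωh
  obtain ⟨-, -, hbw, hinj⟩ := mem_saws_iff.1 hωs
  have hne : ∀ a b : ℕ, a ≤ j + 10 → b ≤ j + 10 → a ≠ b → ¬ (ω a 0 = ω b 0 ∧ ω a 1 = ω b 1) := by
    intro a b ha hb hab h
    have := hinj (show a ∈ {i | i ≤ j + 10} by simp only [Set.mem_setOf_eq]; exact ha)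
      (show b ∈ {i | i ≤ j + 10} by simp only [Set.mem_setOf_eq]; exact hb) ((site_two_eq_iff _ _).2 h)
    exact hab this
  have s7 := Arm.step_cases (hbw (j + 6) (by omega))
  rw [show j + 6 + 1 = j + 7 by omega] at s7
  have s8 := Arm.step_cases (hbw (j + 7) (by omega))
  rw [show j + 7 + 1 = j + 8 by omega] at s8
  have s9 := Arm.step_cases (hbw (j + 8) (by omega))
  rw [show j + 8 + 1 = j + 9 by omega] at s9
  obtain ⟨hY9, hX10⟩ : ω (j + 9) 1 = 0 ∧ (ω (j + 9 + 1) 0 = ω (j + 9) 0 + 1 ∨ ω (j + 9) 0 = ω (j + 9 + 1) 0 + 1) :=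
    arch_last_step (n := j + 9) (by rw [show j + 9 + 1 = j + 6 + 4 by omega]; exact (Finset.mem_filter.1 hω').1)
  rw [show j + 9 + 1 = j + 10 by omega] at hX10
  have hH7 := hH (j + 7) (by omega)
  have hH8 := hH (j + 8) (by omega)
  have hn8 : ¬ (ω (j + 8) 1 = 0) := fun h => hno (j + 8) (by omega) (by omega) ⟨by omega, h⟩
  have h75 := hne (j + 7) (j + 5) (by omega) (by omega) (by omega)
  have h86 := hne (j + 8) (j + 6) (by omega) (by omega) (by omega)
  -- `ω (j+7) = (x+4σ,−1)`
  have hXY7 : ω (j + 7) 1 = -1 ∧ ω (j + 7) 0 = 5 * ω (j + 2) 0 - 4 * ω (j + 1) 0 := by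
    clear hX10 s9 hY9
    constructor <;> omega
  obtain ⟨hY7, hX7⟩ := hXY7
  clear s7 h75
  -- `ω (j+8) = (x+5σ,−1)`
  have hXY8 : ω (j + 8) 1 = -1 ∧ ω (j + 8) 0 = 6 * ω (j + 2) 0 - 5 * ω (j + 1) 0 := by
    clear hX10 hX3 hX4 hX5
    constructor <;> omega
  obtain ⟨hY8, hX8⟩ := hXY8
  clear s8 h86 hn8
  have hX9 : ω (j + 9) 0 = ω (j + 8) 0 := by
    clear hX10 hX3 hX4 hX5 hX6 hX7
    omega
  clear s9
  -- the end: the late hook `(x+4σ,0)` is not three-step extendable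
  have hX10' : ω (j + 10) 0 = 7 * ω (j + 2) 0 - 6 * ω (j + 1) 0 := by
    by_contra h10
    have hhook : ω (j + 10) 0 = 5 * ω (j + 2) 0 - 4 * ω (j + 1) 0 := by omega
    clear hX10 h10
    obtain ⟨z₁, z₂, z₃, hz1, hz2, hz3, hz1', hz2', hz3', hz13, hfresh⟩ := hE
    rw [brickWallGraph_adj_coord] at hz1 hz2 hz3
    have hpar := parity_apply hωs (i := j + 10) le_rfl
    rw [hend] at hpar
    push_cast at hpar
    -- `z₁ = (x+3σ, 0)`
    obtain ⟨f9a, -, -⟩ := hfresh (j + 9) (by omega)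
    have a9 : ¬ (ω (j + 9) 0 = z₁ 0 ∧ ω (j + 9) 1 = z₁ 1) := fun h => f9a ((site_two_eq_iff _ _).2 h)
    have hz1c : z₁ 0 = 4 * ω (j + 2) 0 - 3 * ω (j + 1) 0 ∧ z₁ 1 = 0 := by
      clear hz2 hz3 hz2' hz3' hz13 hX3 hX4 hX5 hX6 hX7
      constructor <;> omega
    obtain ⟨hz1x, hz1y⟩ := hz1c
    clear hz1 a9 f9a
    -- `z₂ = (x+2σ, 0)`
    obtain ⟨-, f10b, -⟩ := hfresh (j + 10) (by omega)
    obtain ⟨-, f6b, -⟩ := hfresh (j + 6) (by omega)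
    have b10 : ¬ (ω (j + 10) 0 = z₂ 0 ∧ ω (j + 10) 1 = z₂ 1) := fun h => f10b ((site_two_eq_iff _ _).2 h)
    have b6 : ¬ (ω (j + 6) 0 = z₂ 0 ∧ ω (j + 6) 1 = z₂ 1) := fun h => f6b ((site_two_eq_iff _ _).2 h)
    have hz2c : z₂ 0 = 3 * ω (j + 2) 0 - 2 * ω (j + 1) 0 ∧ z₂ 1 = 0 := by
      clear hz3 hz3' hz13 hX3 hX4 hX5 hX7 hX8 hX9
      constructor <;> omega
    obtain ⟨hz2x, hz2y⟩ := hz2c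
    clear hz2 b10 b6 f10b f6b
    -- no `z₃`
    obtain ⟨-, -, f3c⟩ := hfresh (j + 3) (by omega)
    have c3 : ¬ (ω (j + 3) 0 = z₃ 0 ∧ ω (j + 3) 1 = z₃ 1) := fun h => f3c ((site_two_eq_iff _ _).2 h)
    have d13 : ¬ (z₁ 0 = z₃ 0 ∧ z₁ 1 = z₃ 1) := fun h => hz13 ((site_two_eq_iff _ _).2 h)
    clear hX4 hX5 hX6 hX7 hX8 hX9 hfresh hz13 f3c
    omega
  exact ⟨hY1, ⟨hX3, hY3⟩, ⟨hX4, hY4⟩, ⟨hX5, hY5⟩, ⟨hX6, hY6⟩, ⟨hX7, hY7⟩, ⟨hX8, hY8⟩, ⟨by omega, hY9⟩, ⟨hX10', hend⟩⟩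

open Classical in
/-- **The flat fibre injects into the three-step-extendable arches eight steps shorter, at the price of one visit**:
`Σ_{ω ∈ fibW (j+6) (j+2), 3-extendable} y^{visits} ≤ y · X³_{j+2}(y)` (`y ≥ 0`, `j ≥ 1`). [cite: HammersleyTorrieWhittington1982, §2 (as summarised by Beaton 2014 arXiv v3 p. 11; locator provisional); EntingJensen2009, §7.4.2, Fig. 7.10] -/
theorem sum_fibW_flat8_le_X3 {j : ℕ} (hj : 1 ≤ j) (hy : 0 ≤ y) :
    ∑ ω ∈ (fibW (j + 6) (j + 2)).filter (Ext3 (j + 10)), y ^ visits (j + 10) ω ≤ y * X3w (j + 2) y := by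
  set D := (fibW (j + 6) (j + 2)).filter (Ext3 (j + 10)) with hD
  set g : (ℕ → Site 2) → (ℕ → Site 2) := fun ω => Zd.prefixWalk (j + 2) ω with hg
  have hmemD : ∀ ω ∈ D, ω ∈ fibW (j + 6) (j + 2) ∧ Ext3 (j + 10) ω := fun ω hω => Finset.mem_filter.1 hω
  have hprops : ∀ ω ∈ D, g ω ∈ archs3 (j + 2) ∧ visits (j + 10) ω = visits (j + 2) (g ω) + 1 := by
    intro ω hω
    obtain ⟨hωf, -⟩ := hmemD ω hω
    obtain ⟨hωh, -, hend, -, hk2, hkY, hno, -⟩ := fibW_anatomy hωf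
    rw [show j + 6 + 4 = j + 10 by omega] at hωh hend
    obtain ⟨hpa, hpv⟩ := prefixWalk_mem_archs3 hωh (show j + 2 + 3 ≤ j + 10 by omega) hk2 hkY
    refine ⟨hpa, ?_⟩
    have e := visits_add_eq_left (k := j + 2) (b := 7) (ζ := ω) (fun i hi1 hi7 h => by
      have hi : i = 2 ∨ i = 4 ∨ i = 6 := by omega
      rcases hi with rfl | rfl | rfl
      · exact hno (j + 4) (by omega) (by omega) ⟨by omega, by rw [show j + 4 = j + 2 + 2 by omega]; exact h.2⟩
      · exact hno (j + 6) (by omega) (by omega) ⟨by omega, by rw [show j + 6 = j + 2 + 4 by omega]; exact h.2⟩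
      · exact hno (j + 8) (by omega) (by omega) ⟨by omega, by rw [show j + 8 = j + 2 + 6 by omega]; exact h.2⟩)
    rw [show j + 10 = j + 2 + 7 + 1 by omega, visits_succ, e, hpv]
    have h10 : (j + 2 + 7 + 1) % 2 = 0 ∧ ω (j + 2 + 7 + 1) 1 = 0 :=
      ⟨by omega, by rw [show j + 2 + 7 + 1 = j + 10 by omega]; exact hend⟩
    rw [if_pos h10]
  have hinj : Set.InjOn g ↑D := by
    intro ω hω ω' hω' h
    rw [Finset.mem_coe] at hω hω'
    obtain ⟨hωf, hE⟩ := hmemD ω hω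
    obtain ⟨hωf', hE'⟩ := hmemD ω' hω'
    have hc := flat8_coords hj hωf hE
    have hc' := flat8_coords hj hωf' hE'
    have hωs : ω ∈ saws (j + 10) := by
      have := (fibW_anatomy hωf).1; rw [show j + 6 + 4 = j + 10 by omega] at this; exact hpw_subset this
    have hωs' : ω' ∈ saws (j + 10) := by
      have := (fibW_anatomy hωf').1; rw [show j + 6 + 4 = j + 10 by omega] at this; exact hpw_subset this
    have hagree : ∀ i ≤ j + 2, ω i = ω' i := fun i hi => by
      have := congrFun h i
      simpa [hg, Zd.prefixWalk, min_eq_left hi] using this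
    have e1 : ω (j + 1) 0 = ω' (j + 1) 0 := by rw [hagree (j + 1) (by omega)]
    have e2 : ω (j + 2) 0 = ω' (j + 2) 0 := by rw [hagree (j + 2) le_rfl]
    obtain ⟨-, ⟨a0, a1⟩, ⟨b0, b1⟩, ⟨c0, c1⟩, ⟨d0, d1⟩, ⟨f0, f1⟩, ⟨g0, g1⟩, ⟨h0, h1⟩, ⟨i0, i1⟩⟩ := hc
    obtain ⟨-, ⟨a0', a1'⟩, ⟨b0', b1'⟩, ⟨c0', c1'⟩, ⟨d0', d1'⟩, ⟨f0', f1'⟩, ⟨g0', g1'⟩, ⟨h0', h1'⟩, ⟨i0', i1'⟩⟩ := hc'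
    refine Arm.eq_of_agree hωs hωs' fun i hi => ?_
    rcases Nat.lt_or_ge i (j + 3) with hi' | hi'
    · exact hagree i (by omega)
    · rw [site_two_eq_iff]
      have hcase : i = j + 3 ∨ i = j + 4 ∨ i = j + 5 ∨ i = j + 6 ∨ i = j + 7 ∨ i = j + 8 ∨ i = j + 9 ∨ i = j + 10 := by omega
      rcases hcase with rfl | rfl | rfl | rfl | rfl | rfl | rfl | rfl
      · exact ⟨by rw [a0, a0', e1, e2], by rw [a1, a1']⟩
      · exact ⟨by rw [b0, b0', e1, e2], by rw [b1, b1']⟩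
      · exact ⟨by rw [c0, c0', e1, e2], by rw [c1, c1']⟩
      · exact ⟨by rw [d0, d0', e1, e2], by rw [d1, d1']⟩
      · exact ⟨by rw [f0, f0', e1, e2], by rw [f1, f1']⟩
      · exact ⟨by rw [g0, g0', e1, e2], by rw [g1, g1']⟩
      · exact ⟨by rw [h0, h0', e1, e2], by rw [h1, h1']⟩
      · exact ⟨by rw [i0, i0', e1, e2], by rw [i1, i1']⟩
  calc ∑ ω ∈ D, y ^ visits (j + 10) ω = ∑ ω ∈ D, y * y ^ visits (j + 2) (g ω) :=
        Finset.sum_congr rfl fun ω hω => by rw [(hprops ω hω).2, pow_succ, mul_comm]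
    _ = y * ∑ ξ ∈ D.image g, y ^ visits (j + 2) ξ := by rw [Finset.mul_sum, Finset.sum_image hinj]
    _ ≤ y * X3w (j + 2) y := by
        refine mul_le_mul_of_nonneg_left ?_ hy
        rw [X3w]
        refine Finset.sum_le_sum_of_subset_of_nonneg (fun ξ hξ => ?_) fun _ _ _ => pow_nonneg hy _
        obtain ⟨ω, hω, rfl⟩ := Finset.mem_image.1 hξ
        exact (hprops ω hω).1

/-! ### §6  The recursion for the three-step-extendable count -/

open Classical in
/-- ★★ **THE THIRD-ORDER RECURSION** (`y ≥ 0`, `j ≥ 1`, arches of length `j+10`):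
`X³_{j+10} ≤ y X³_{j+8} + y X³_{j+4} + y X³_{j+2} + 2y Σ_{k ≤ j} X³_k c_{j+9−k}(ℍ)` — straight block, dip (length 6), FLAT excursion
(length 8, ONE shape: the late hook is not three-step extendable), and the excursions of length `≥ 10` bounded by all walks; the fibres of
excursion lengths `3, 4, 5, 7, 9` are empty (odd, or `not_mem_fibW_diag`).  Characteristic equation `1 = yz + yz³ + yz⁴ + O(yz⁵)`, `z = β⁻²`.
[cite: HammersleyTorrieWhittington1982, §2 (unfolded surface walks, as summarised by Beaton 2014 arXiv v3 p. 11; locator provisional); JansevanRensburg2000, §3.3.2, Lemma 3.20; MadrasSlade1993, §1.2, (1.2.3)] -/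
theorem X3w_le_rec {j : ℕ} (hj : 1 ≤ j) (hy : 0 ≤ y) :
    X3w (j + 10) y ≤ y * X3w (j + 8) y + y * X3w (j + 4) y + y * X3w (j + 2) y +
      2 * y * ∑ k ∈ range (j + 1), X3w k y * #(saws (j + 9 - k)) := by
  classical
  set T : ℕ → ℝ := fun k => ∑ ω ∈ (archs3 (j + 10)).filter (fun ω => lastV (j + 8) ω = k), y ^ visits (j + 10) ω with hT
  have hf : ∀ ω ∈ archs3 (j + 10), lastV (j + 8) ω ∈ range (j + 9) :=
    fun ω _ => Finset.mem_range.2 (Nat.lt_succ_of_le (lastV_le _ _))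
  have hX : X3w (j + 10) y = ∑ k ∈ range (j + 9), T k := by
    rw [X3w, ← Finset.sum_fiberwise_of_maps_to hf]
  have hsub : ∀ k, (archs3 (j + 10)).filter (fun ω => lastV (j + 8) ω = k) ⊆ (fibW (j + 6) k).filter (Ext3 (j + 10)) := by
    intro k ω hω
    obtain ⟨hωX, hl⟩ := Finset.mem_filter.1 hω
    obtain ⟨hωa, hE⟩ := mem_archs3.1 hωX
    refine Finset.mem_filter.2 ⟨Finset.mem_filter.2 ⟨?_, ?_⟩, hE⟩
    · rw [show j + 6 + 4 = j + 10 by omega]; exact hωa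
    · rw [show j + 6 + 2 = j + 8 by omega]; exact hl
  have hTle : ∀ k, T k ≤ ∑ ω ∈ fibW (j + 6) k, y ^ visits (j + 10) ω := fun k =>
    Finset.sum_le_sum_of_subset_of_nonneg ((hsub k).trans (Finset.filter_subset _ _)) fun _ _ _ => pow_nonneg hy _
  have hTleE : ∀ k, T k ≤ ∑ ω ∈ (fibW (j + 6) k).filter (Ext3 (j + 10)), y ^ visits (j + 10) ω := fun k =>
    Finset.sum_le_sum_of_subset_of_nonneg (hsub k) fun _ _ _ => pow_nonneg hy _
  have hT0 : ∀ ω : ℕ → Site 2, visits (j + 6 + 4) ω = visits (j + 10) ω := fun ω => by rw [show j + 6 + 4 = j + 10 by omega]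
  -- the straight fibre
  have h8 : T (j + 8) ≤ y * X3w (j + 8) y := by
    refine (hTleE _).trans ?_
    have h := sum_fibW_self_le_X3 (j + 6) hy
    rw [show j + 6 + 2 = j + 8 by omega, show j + 6 + 4 = j + 10 by omega] at h
    exact h
  -- the three empty fibres next to it and the odd fibres `j+3`, `j+1`
  have h7 : T (j + 7) ≤ 0 := (hTle _).trans (by
    have h := sum_fibW_eq_zero_of_near (m := j + 6) (k := j + 7) (by omega) (by omega) y
    simpa only [hT0] using h.le)
  have h6 : T (j + 6) ≤ 0 := (hTle _).trans (by
    have h := sum_fibW_eq_zero_of_near (m := j + 6) (k := j + 6) (by omega) (by omega) y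
    simpa only [hT0] using h.le)
  have h5 : T (j + 5) ≤ 0 := (hTle _).trans (by
    have h := sum_fibW_eq_zero_of_near (m := j + 6) (k := j + 5) (by omega) (by omega) y
    simpa only [hT0] using h.le)
  have h3 : T (j + 3) ≤ 0 := (hTle _).trans (by
    refine (Finset.sum_eq_zero fun ω hω => ?_).le
    obtain ⟨-, hm, -, -, hk0, -⟩ := fibW_anatomy hω
    omega)
  have h1 : T (j + 1) ≤ 0 := (hTle _).trans (by
    refine (Finset.sum_eq_zero fun ω hω => ?_).le
    obtain ⟨-, hm, -, -, hk0, -⟩ := fibW_anatomy hω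
    omega)
  -- the dip fibre (`k = j+4`)
  have h4 : T (j + 4) ≤ y * X3w (j + 4) y := by
    refine (hTleE _).trans ?_
    have h := sum_fibW_dip_le_X3 (j + 2) hy
    rw [show j + 2 + 4 = j + 6 by omega, show j + 2 + 2 = j + 4 by omega, show j + 2 + 8 = j + 10 by omega] at h
    exact h
  -- the flat fibre (`k = j+2`)
  have h2 : T (j + 2) ≤ y * X3w (j + 2) y := (hTleE _).trans (sum_fibW_flat8_le_X3 hj hy)
  -- the long fibres
  have h0 : ∑ k ∈ range (j + 1), T k ≤ 2 * y * ∑ k ∈ range (j + 1), X3w k y * #(saws (j + 9 - k)) := by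
    rw [Finset.mul_sum]
    refine Finset.sum_le_sum fun k hk => (hTle k).trans ?_
    have hk' := Finset.mem_range.1 hk
    have h := sum_fibW_le_X3 (j + 6) hy (k := k) (by omega)
    rw [show j + 6 + 3 - k = j + 9 - k by omega] at h
    simpa only [hT0] using h
  rw [hX, Finset.sum_range_succ, Finset.sum_range_succ, Finset.sum_range_succ, Finset.sum_range_succ, Finset.sum_range_succ,
    Finset.sum_range_succ, Finset.sum_range_succ, Finset.sum_range_succ]
  linarith

/-! ### §7  The growth bound with the third-order condition `y/ρ² + y/ρ⁶ + y/ρ⁸ + 78732·y/ρ¹⁰ ≤ 1` -/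

open Classical in
/-- A priori: `X³_n(y) ≤ 3ⁿ yⁿ` for `y ≥ 1`. [cite: MadrasSlade1993, §1.2, (1.2.3)] -/
theorem X3w_le_three_pow_mul_pow (n : ℕ) (hy : 1 ≤ y) : X3w n y ≤ 3 ^ n * y ^ n := by
  have hy0 : 0 ≤ y := by linarith
  have h1 := (X3w_le_Aw n hy0).trans (Aw_le_card_mul_pow n hy0)
  rw [max_eq_right hy] at h1
  exact h1.trans (mul_le_mul_of_nonneg_right (Arm.card_saws_le_three_pow n) (pow_nonneg hy0 _))

open Classical in
/-- **The growth bound** (`y ≥ 1`): if `ρ ≥ 6` and `y/ρ² + y/ρ⁶ + y/ρ⁸ + 78732·y/ρ¹⁰ ≤ 1` then `X³_n(y) ≤ 59049 y¹⁰ · ρⁿ` for every `n`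
(`78732 = 4·3⁹`, `59049 = 3¹⁰`). [cite: HammersleyTorrieWhittington1982, §2 (as summarised by Beaton 2014 arXiv v3 p. 11; locator provisional); MadrasSlade1993, §1.2, Lemma 1.2.2] -/
theorem X3w_le_mul_pow (hy : 1 ≤ y) {ρ : ℝ} (hρ : 6 ≤ ρ) (hc : y / ρ ^ 2 + y / ρ ^ 6 + y / ρ ^ 8 + 78732 * y / ρ ^ 10 ≤ 1) (n : ℕ) :
    X3w n y ≤ 59049 * y ^ 10 * ρ ^ n := by
  have hy0 : 0 ≤ y := by linarith
  have hρ1 : 1 ≤ ρ := by linarith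
  have hρ0 : 0 < ρ := by linarith
  induction n using Nat.strong_induction_on with
  | _ n ih =>
  rcases Nat.lt_or_ge n 11 with hn | hn
  · have h1 := X3w_le_three_pow_mul_pow n hy
    have h3 : (3 : ℝ) ^ n ≤ 59049 := by
      calc (3 : ℝ) ^ n ≤ 3 ^ 10 := pow_le_pow_right₀ (by norm_num) (by omega)
        _ = 59049 := by norm_num
    have h4 : y ^ n ≤ y ^ 10 := pow_le_pow_right₀ hy (by omega)
    have h5 : (1 : ℝ) ≤ ρ ^ n := one_le_pow₀ hρ1
    calc X3w n y ≤ 3 ^ n * y ^ n := h1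
      _ ≤ 59049 * y ^ 10 := mul_le_mul h3 h4 (pow_nonneg hy0 _) (by norm_num)
      _ = 59049 * y ^ 10 * 1 := (mul_one _).symm
      _ ≤ 59049 * y ^ 10 * ρ ^ n := mul_le_mul_of_nonneg_left h5 (by positivity)
  · obtain ⟨j, rfl⟩ : ∃ j, n = j + 10 := ⟨n - 10, by omega⟩
    have hj : 1 ≤ j := by omega
    set M : ℝ := 59049 * y ^ 10 with hM
    have hM0 : 0 ≤ M := by positivity
    have hrec := X3w_le_rec hj hy0
    have b8 : X3w (j + 8) y ≤ M * ρ ^ (j + 8) := ih (j + 8) (by omega)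
    have b4 : X3w (j + 4) y ≤ M * ρ ^ (j + 4) := ih (j + 4) (by omega)
    have b2 : X3w (j + 2) y ≤ M * ρ ^ (j + 2) := ih (j + 2) (by omega)
    have bS : ∑ k ∈ range (j + 1), X3w k y * (#(saws (j + 9 - k)) : ℝ) ≤ M * (39366 * ρ ^ j) := by
      calc ∑ k ∈ range (j + 1), X3w k y * (#(saws (j + 9 - k)) : ℝ)
          ≤ ∑ k ∈ range (j + 1), M * ρ ^ k * 3 ^ (j + 9 - k) := by
            refine Finset.sum_le_sum fun k hk => ?_
            exact mul_le_mul (ih k (by have := Finset.mem_range.1 hk; omega)) (Arm.card_saws_le_three_pow _)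
              (by positivity) (by positivity)
        _ = M * ∑ k ∈ range (j + 1), ρ ^ k * 3 ^ (j + 9 - k) := by
            rw [Finset.mul_sum]; exact Finset.sum_congr rfl fun k _ => by ring
        _ ≤ M * (2 * 3 ^ 9 * ρ ^ j) := mul_le_mul_of_nonneg_left (Arm.sum_pow_mul_three_pow_le hρ j 9) hM0
        _ = M * (39366 * ρ ^ j) := by norm_num
    have key : y * ρ ^ (j + 8) + y * ρ ^ (j + 4) + y * ρ ^ (j + 2) + 78732 * y * ρ ^ j ≤ ρ ^ (j + 10) := by
      have h := mul_le_mul_of_nonneg_right hc (pow_nonneg hρ0.le (j + 10))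
      rw [one_mul] at h
      have e : (y / ρ ^ 2 + y / ρ ^ 6 + y / ρ ^ 8 + 78732 * y / ρ ^ 10) * ρ ^ (j + 10) =
          y * ρ ^ (j + 8) + y * ρ ^ (j + 4) + y * ρ ^ (j + 2) + 78732 * y * ρ ^ j := by
        field_simp
        ring
      linarith
    have c8 : y * X3w (j + 8) y ≤ y * (M * ρ ^ (j + 8)) := mul_le_mul_of_nonneg_left b8 hy0
    have c4 : y * X3w (j + 4) y ≤ y * (M * ρ ^ (j + 4)) := mul_le_mul_of_nonneg_left b4 hy0
    have c2 : y * X3w (j + 2) y ≤ y * (M * ρ ^ (j + 2)) := mul_le_mul_of_nonneg_left b2 hy0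
    have cS : 2 * y * ∑ k ∈ range (j + 1), X3w k y * (#(saws (j + 9 - k)) : ℝ) ≤ 2 * y * (M * (39366 * ρ ^ j)) :=
      mul_le_mul_of_nonneg_left bS (by positivity)
    have key' := mul_le_mul_of_nonneg_left key hM0
    calc X3w (j + 10) y
        ≤ y * X3w (j + 8) y + y * X3w (j + 4) y + y * X3w (j + 2) y +
            2 * y * ∑ k ∈ range (j + 1), X3w k y * (#(saws (j + 9 - k)) : ℝ) := hrec
      _ ≤ y * (M * ρ ^ (j + 8)) + y * (M * ρ ^ (j + 4)) + y * (M * ρ ^ (j + 2)) + 2 * y * (M * (39366 * ρ ^ j)) := by linarith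
      _ = M * (y * ρ ^ (j + 8) + y * ρ ^ (j + 4) + y * ρ ^ (j + 2) + 78732 * y * ρ ^ j) := by ring
      _ ≤ M * ρ ^ (j + 10) := key'

/-! ### §8  THE THIRD-ORDER UPPER WINDOW `β(y)² ≤ y + 1/y + 1/y² + 3¹¹/y³` for every `y ≥ 1` -/

/-- `36 ≤ y + 177147/y³` for `y ≥ 1` — indeed `y⁴ − 36y³ + 3¹¹ = (y − 27)² (y² + 18y + 243)`, with equality exactly at `y = 27`; so
`ρ² = y + 1/y + 1/y² + 3¹¹/y³ ≥ 36` with no threshold on the fugacity. [cite: MadrasSlade1993, §1.2, Lemma 1.2.2] -/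
theorem thirtysix_le_thirdB (hy : 1 ≤ y) : (36 : ℝ) ≤ y + 1 / y + 1 / y ^ 2 + 177147 / y ^ 3 := by
  have hy0 : 0 < y := by linarith
  have h1 : (0 : ℝ) ≤ 1 / y := by positivity
  have h2 : (0 : ℝ) ≤ 1 / y ^ 2 := by positivity
  have h3 : (36 : ℝ) ≤ y + 177147 / y ^ 3 := by
    rw [← sub_nonneg]
    have e : y + 177147 / y ^ 3 - 36 = ((y - 27) ^ 2 * (y ^ 2 + 18 * y + 243)) / y ^ 3 := by
      field_simp
      ring
    rw [e]
    positivity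
  linarith

set_option maxHeartbeats 400000 in
/-- ★★★ **THE THIRD-ORDER UPPER WINDOW: `β(y)² ≤ y + 1/y + 1/y² + 177147/y³` for every `y ≥ 1`** (`177147 = 3¹¹`).  With
`B = y + 1/y + 1/y² + 3¹¹/y³`, `ρ = √B`: `B⁵ − yB⁴ = B⁴ (1/y + 1/y² + 3¹¹/y³) ≥ yB² + yB + 78732 y`, so the third-order condition holds;
`B^w_n ≤ X³_n ≤ 3¹⁰ y¹⁰ ρⁿ` and the Fekete transfer give `β ≤ ρ`.  Hence `limsup_{y→∞} y² (β(y)² − y − 1/y) ≤ 1`: the THIRD coefficient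
of the adsorbed-phase expansion is AT MOST one (one flat excursion of length eight per slot; the renewal heuristic predicts exactly one).
[cite: BeatonBousquetMelouDeGierDuminilCopinGuttmann2014, §3.1 (arXiv v5 p. 10: "This translates into μ(y) ∼ √y in our honeycomb setting" — first order, stated without proof); JansevanRensburg2000, §3.3.2, Lemma 3.20; RychlewskiWhittington2011, Theorem (square-lattice first-order analogue; not held)] -/
theorem wallRate_sq_le_third (hy : 1 ≤ y) : wallRate y ^ 2 ≤ y + 1 / y + 1 / y ^ 2 + 177147 / y ^ 3 := by
  have hy0 : 0 < y := by linarith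
  set B : ℝ := y + 1 / y + 1 / y ^ 2 + 177147 / y ^ 3 with hB
  have hB36 : 36 ≤ B := thirtysix_le_thirdB hy
  have hB0 : 0 < B := by linarith
  have hyB : y ≤ B := by
    have h1 : (0 : ℝ) ≤ 1 / y := by positivity
    have h2 : (0 : ℝ) ≤ 1 / y ^ 2 := by positivity
    have h3 : (0 : ℝ) ≤ 177147 / y ^ 3 := by positivity
    rw [hB]; linarith
  set ρ := Real.sqrt B with hρ
  have hρ0 : 0 < ρ := Real.sqrt_pos.2 hB0
  have hρsq : ρ ^ 2 = B := Real.sq_sqrt hB0.le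
  have hρ6 : 6 ≤ ρ := by
    rw [hρ, ← Real.sqrt_sq (by norm_num : (0 : ℝ) ≤ 6)]
    exact Real.sqrt_le_sqrt (by norm_num; exact hB36)
  have hc : y / ρ ^ 2 + y / ρ ^ 6 + y / ρ ^ 8 + 78732 * y / ρ ^ 10 ≤ 1 := by
    have h6 : ρ ^ 6 = B ^ 3 := by rw [show (6 : ℕ) = 2 * 3 by norm_num, pow_mul, hρsq]
    have h8 : ρ ^ 8 = B ^ 4 := by rw [show (8 : ℕ) = 2 * 4 by norm_num, pow_mul, hρsq]
    have h10 : ρ ^ 10 = B ^ 5 := by rw [show (10 : ℕ) = 2 * 5 by norm_num, pow_mul, hρsq]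
    rw [hρsq, h6, h8, h10]
    have e : y / B + y / B ^ 3 + y / B ^ 4 + 78732 * y / B ^ 5 = (y * B ^ 4 + y * B ^ 2 + y * B + 78732 * y) / B ^ 5 := by
      field_simp
    rw [e, div_le_one (by positivity)]
    have hBy : B - y = 1 / y + 1 / y ^ 2 + 177147 / y ^ 3 := by rw [hB]; ring
    have hB3 : y ^ 3 ≤ B ^ 3 := pow_le_pow_left₀ hy0.le hyB 3
    have hB4 : y ^ 4 ≤ B ^ 4 := pow_le_pow_left₀ hy0.le hyB 4
    have hB2' : y * B ≤ B ^ 2 := by nlinarith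
    have t1 : y * B ^ 2 ≤ B ^ 4 * (1 / y) := by
      rw [mul_one_div, le_div_iff₀ hy0]
      have h1 : y * B ^ 2 * y = (y * B) * (y * B) := by ring
      have h2 : B ^ 4 = B ^ 2 * B ^ 2 := by ring
      rw [h1, h2]
      exact mul_le_mul hB2' hB2' (by positivity) (by positivity)
    have t2 : y * B ≤ B ^ 4 * (1 / y ^ 2) := by
      rw [mul_one_div, le_div_iff₀ (by positivity)]
      have h1 : y * B * y ^ 2 = y ^ 3 * B := by ring
      have h2 : B ^ 4 = B ^ 3 * B := by ring
      rw [h1, h2]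
      exact mul_le_mul_of_nonneg_right hB3 hB0.le
    have t3 : 78732 * y ≤ B ^ 4 * (177147 / y ^ 3) := by
      rw [mul_div_assoc', le_div_iff₀ (by positivity)]
      have h1 : 78732 * y * y ^ 3 = 78732 * y ^ 4 := by ring
      rw [h1]
      have h2 : 78732 * y ^ 4 ≤ 78732 * B ^ 4 := mul_le_mul_of_nonneg_left hB4 (by norm_num)
      have h3 : 78732 * B ^ 4 ≤ B ^ 4 * 177147 := by nlinarith [pow_pos hB0 4]
      linarith
    have key : y * B ^ 2 + y * B + 78732 * y ≤ B ^ 4 * (B - y) := by rw [hBy, mul_add, mul_add]; linarith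
    have e5 : B ^ 4 * (B - y) = B ^ 5 - y * B ^ 4 := by ring
    linarith
  have hA := X3w_le_mul_pow hy hρ6 hc
  have hW : ∀ n, WB n y ≤ 59049 * y ^ 10 * ρ ^ n := fun n => (WB_le_X3w n hy0.le).trans (hA n)
  have hβρ : wallRate y ≤ ρ := wallRate_le_of_WB_le hy0 (by positivity) hρ0 hW
  calc wallRate y ^ 2 ≤ ρ ^ 2 := pow_le_pow_left₀ (wallRate_pos y).le hβρ 2
    _ = B := hρsq

/-- ★★ **`y² · (β(y)² − y − 1/y) ≤ 1 + 177147/y`** (`y ≥ 1`): `limsup_{y→∞} y² (β(y)² − y − 1/y) ≤ 1`.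
[cite: BeatonBousquetMelouDeGierDuminilCopinGuttmann2014, §3.1 (arXiv v5 p. 10 remark); JansevanRensburg2000, §3.3.2, Lemma 3.20] -/
theorem sq_mul_wallRate_sq_sub_sub_le (hy : 1 ≤ y) : y ^ 2 * (wallRate y ^ 2 - y - 1 / y) ≤ 1 + 177147 / y := by
  have hy0 : 0 < y := by linarith
  have h := mul_le_mul_of_nonneg_left (wallRate_sq_le_third hy) (by positivity : (0 : ℝ) ≤ y ^ 2)
  have e : y ^ 2 * (y + 1 / y + 1 / y ^ 2 + 177147 / y ^ 3) = y ^ 2 * y + y + 1 + 177147 / y := by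
    field_simp
  have e2 : y ^ 2 * (wallRate y ^ 2 - y - 1 / y) = y ^ 2 * wallRate y ^ 2 - y ^ 2 * y - y := by
    field_simp
  rw [e2]
  nlinarith

/-! ### §9  THE THIRD-ORDER LAW: `β(y)² = y + 1/y + 1/y² + O(y⁻³)`, `y² (β(y)² − y − 1/y) → 1` -/

/-- ★★ **The third-order LOWER window made unconditional**: `y + 1/y + 1/y² − 26247/y³ − 34996/y⁴ ≤ β(y)²` for every `y ≥ 1` —
`HexSAWSurfaceThirdOrderLower.third_window_lower` (two-seed renewal) fed with the parent's upper window `β² ≤ y + 8749/y`.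
[cite: JansevanRensburg2000, §3.3.2, Lemma 3.20; HammersleyTorrieWhittington1982, §2] -/
theorem third_lower_window (hy : 1 ≤ y) : y + 1 / y + 1 / y ^ 2 - 26247 / y ^ 3 - 34996 / y ^ 4 ≤ wallRate y ^ 2 := by
  have hy0 : 0 < y := by linarith
  have h := third_window_lower hy0 (C := 8749) (by norm_num) (wallRate_sq_le_add_div hy)
  have e1 : (3 : ℝ) * 8749 / y ^ 3 = 26247 / y ^ 3 := by norm_num
  have e2 : (4 : ℝ) * 8749 / y ^ 4 = 34996 / y ^ 4 := by norm_num
  linarith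

/-- ★★★ **THE TWO-SIDED THIRD-ORDER WINDOW**: `β(y)² − y − 1/y − 1/y² ∈ [−26247/y³ − 34996/y⁴, 177147/y³]` for every `y ≥ 1` —
`β(y)² = y + 1/y + 1/y² + O(y⁻³)`. [cite: BeatonBousquetMelouDeGierDuminilCopinGuttmann2014, §3.1 (arXiv v5 p. 10: first-order remark); JansevanRensburg2000, §3.3.2, Lemma 3.20] -/
theorem wallRate_sq_third_mem_Icc (hy : 1 ≤ y) :
    wallRate y ^ 2 - y - 1 / y - 1 / y ^ 2 ∈ Set.Icc (-(26247 / y ^ 3 + 34996 / y ^ 4)) (177147 / y ^ 3) := by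
  constructor
  · have := third_lower_window hy; linarith
  · have := wallRate_sq_le_third hy; linarith

/-- ★★★ **`y² (β(y)² − y − 1/y) ∈ [1 − 26247/y − 34996/y², 1 + 177147/y]`** for every `y ≥ 1`. [cite: JansevanRensburg2000, §3.3.2, Lemma 3.20; BeatonBousquetMelouDeGierDuminilCopinGuttmann2014, §3.1 (arXiv v5 p. 10 remark)] -/
theorem sq_mul_wallRate_sq_sub_sub_mem_Icc (hy : 1 ≤ y) :
    y ^ 2 * (wallRate y ^ 2 - y - 1 / y) ∈ Set.Icc (1 - 26247 / y - 34996 / y ^ 2) (1 + 177147 / y) := by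
  have hy0 : 0 < y := by linarith
  refine ⟨?_, sq_mul_wallRate_sq_sub_sub_le hy⟩
  have h := mul_le_mul_of_nonneg_left (third_lower_window hy) (by positivity : (0 : ℝ) ≤ y ^ 2)
  have e : y ^ 2 * (y + 1 / y + 1 / y ^ 2 - 26247 / y ^ 3 - 34996 / y ^ 4) = y ^ 2 * y + y + 1 - 26247 / y - 34996 / y ^ 2 := by
    field_simp
  have e2 : y ^ 2 * (wallRate y ^ 2 - y - 1 / y) = y ^ 2 * wallRate y ^ 2 - y ^ 2 * y - y := by
    field_simp
  rw [e2]
  nlinarith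

/-- ★★★ **`y² · (β(y)² − y − 1/y) → 1` as `y → ∞`: the THIRD coefficient of the adsorbed-phase growth rate is EXACTLY ONE** (one flat
excursion of length eight per slot — the late hook being dead — from above; dips and flat excursions interleaved freely from below).
[cite: BeatonBousquetMelouDeGierDuminilCopinGuttmann2014, §3.1 (arXiv v5 p. 10: "This translates into μ(y) ∼ √y in our honeycomb setting" — first order, without proof); JansevanRensburg2000, §3.3.2, Lemma 3.20; RychlewskiWhittington2011, Theorem (square-lattice first-order analogue; not held)] -/
theorem tendsto_sq_mul_wallRate_sq_sub_sub : Tendsto (fun y : ℝ => y ^ 2 * (wallRate y ^ 2 - y - 1 / y)) atTop (𝓝 1) := by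
  have hlo : Tendsto (fun y : ℝ => (1 : ℝ) - 26247 / y - 34996 / y ^ 2) atTop (𝓝 (1 - 0 - 0)) := by
    refine (tendsto_const_nhds.sub (tendsto_const_nhds.div_atTop tendsto_id)).sub ?_
    exact tendsto_const_nhds.div_atTop (tendsto_pow_atTop two_ne_zero)
  have hhi : Tendsto (fun y : ℝ => (1 : ℝ) + 177147 / y) atTop (𝓝 (1 + 0)) :=
    tendsto_const_nhds.add (tendsto_const_nhds.div_atTop tendsto_id)
  rw [sub_zero, sub_zero] at hlo
  rw [add_zero] at hhi
  refine tendsto_of_tendsto_of_tendsto_of_le_of_le' hlo hhi ?_ ?_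
  · filter_upwards [eventually_ge_atTop (1 : ℝ)] with y hy using (sq_mul_wallRate_sq_sub_sub_mem_Icc hy).1
  · filter_upwards [eventually_ge_atTop (1 : ℝ)] with y hy using (sq_mul_wallRate_sq_sub_sub_mem_Icc hy).2

/-- ★★ **`β(y)² − y − 1/y − 1/y² = O(y⁻³)`.** [cite: JansevanRensburg2000, §3.3.2, Lemma 3.20; BeatonBousquetMelouDeGierDuminilCopinGuttmann2014, §3.1 (arXiv v5 p. 10 remark)] -/
theorem isBigO_wallRate_sq_third :
    (fun y : ℝ => wallRate y ^ 2 - y - 1 / y - 1 / y ^ 2) =O[atTop] (fun y : ℝ => (y ^ 3)⁻¹) := by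
  refine Asymptotics.IsBigO.of_bound 177147 ?_
  filter_upwards [eventually_ge_atTop (1 : ℝ)] with y hy
  have hy0 : 0 < y := by linarith
  obtain ⟨h1, h2⟩ := wallRate_sq_third_mem_Icc hy
  rw [Real.norm_eq_abs, Real.norm_of_nonneg (inv_nonneg.2 (by positivity)), abs_le]
  have h3 : (26247 : ℝ) / y ^ 3 + 34996 / y ^ 4 ≤ 177147 * (y ^ 3)⁻¹ := by
    rw [← div_eq_mul_inv]
    have a : (34996 : ℝ) / y ^ 4 ≤ 34996 / y ^ 3 := by
      apply div_le_div_of_nonneg_left (by norm_num) (by positivity)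
      nlinarith [pow_pos hy0 3]
    have b : (26247 : ℝ) / y ^ 3 + 34996 / y ^ 3 ≤ 177147 / y ^ 3 := by
      rw [← add_div]; gcongr; norm_num
    linarith
  have h4 : (177147 : ℝ) / y ^ 3 = 177147 * (y ^ 3)⁻¹ := div_eq_mul_inv _ _
  constructor <;> linarith

/-- Eventually `y² (β(y)² − y − 1/y) ≤ 1 + ε` and `≥ 1 − ε` for every `ε > 0` (window form of the limit).
[cite: JansevanRensburg2000, §3.3.2, Lemma 3.20] -/
theorem eventually_abs_sq_mul_wallRate_sq_sub_sub_sub_one_le {ε : ℝ} (hε : 0 < ε) :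
    ∀ᶠ y : ℝ in atTop, |y ^ 2 * (wallRate y ^ 2 - y - 1 / y) - 1| ≤ ε := by
  have h := tendsto_sq_mul_wallRate_sq_sub_sub
  have h2 : Tendsto (fun y : ℝ => y ^ 2 * (wallRate y ^ 2 - y - 1 / y) - 1) atTop (𝓝 0) := by
    have := h.sub_const 1; rwa [sub_self] at this
  exact (Metric.tendsto_nhds.1 h2 ε hε).mono fun y hy => by
    rw [Real.dist_eq, sub_zero] at hy; exact hy.le

/-! ### §10  The same laws for BBdGDCG's `μ(y)` (`HV.surfaceMu = β` for every `y > 0`, `HexSAWSurfaceWallRateEq`) -/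

/-- ★★★ **For BBdGDCG's surface growth rate `μ(y)` (Proposition 5): `μ(y)² − y − 1/y − 1/y² ∈ [−26247/y³ − 34996/y⁴, 3¹¹/y³]` for every
`y ≥ 1`** — `μ(y)² = y + 1/y + 1/y² + O(y⁻³)`. [cite: BeatonBousquetMelouDeGierDuminilCopinGuttmann2014, §3.1, Proposition 5 (arXiv v5 p. 9) and p. 10 ("This translates into μ(y) ∼ √y in our honeycomb setting"); JansevanRensburg2000, §3.3.2, Lemma 3.20] -/
theorem surfaceMu_sq_third_mem_Icc (hy : 1 ≤ y) :
    HV.surfaceMu y ^ 2 - y - 1 / y - 1 / y ^ 2 ∈ Set.Icc (-(26247 / y ^ 3 + 34996 / y ^ 4)) (177147 / y ^ 3) := by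
  rw [← HV.wallRate_eq_surfaceMu (by linarith)]
  exact wallRate_sq_third_mem_Icc hy

/-- ★★★ **`y · (μ(y)² − y) → 1`** for BBdGDCG's `μ(y)`. [cite: BeatonBousquetMelouDeGierDuminilCopinGuttmann2014, §3.1, Proposition 5 (arXiv v5 p. 9) and p. 10 remark] -/
theorem tendsto_mul_surfaceMu_sq_sub : Tendsto (fun y : ℝ => y * (HV.surfaceMu y ^ 2 - y)) atTop (𝓝 1) := by
  refine tendsto_mul_wallRate_sq_sub.congr' ?_
  filter_upwards [eventually_gt_atTop (0 : ℝ)] with y hy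
  rw [HV.wallRate_eq_surfaceMu hy]

/-- ★★★ **`y² · (μ(y)² − y − 1/y) → 1`** for BBdGDCG's `μ(y)`. [cite: BeatonBousquetMelouDeGierDuminilCopinGuttmann2014, §3.1, Proposition 5 (arXiv v5 p. 9) and p. 10 remark] -/
theorem tendsto_sq_mul_surfaceMu_sq_sub_sub : Tendsto (fun y : ℝ => y ^ 2 * (HV.surfaceMu y ^ 2 - y - 1 / y)) atTop (𝓝 1) := by
  refine tendsto_sq_mul_wallRate_sq_sub_sub.congr' ?_
  filter_upwards [eventually_gt_atTop (0 : ℝ)] with y hy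
  rw [HV.wallRate_eq_surfaceMu hy]

/-- ★★ **`y^{3/2} · (μ(y) − √y) → ½`** and the surface free energy `log μ(y) = ½ log y + 1/(2y²) + o(y⁻²)`: `y² (log μ(y) − ½ log y) → ½`.
[cite: BeatonBousquetMelouDeGierDuminilCopinGuttmann2014, §3.1, Proposition 5 (arXiv v5 p. 9) and p. 10 remark] -/
theorem tendsto_surfaceMu_sqrt_and_log :
    Tendsto (fun y : ℝ => y * Real.sqrt y * (HV.surfaceMu y - Real.sqrt y)) atTop (𝓝 (1 / 2)) ∧
      Tendsto (fun y : ℝ => y ^ 2 * (Real.log (HV.surfaceMu y) - Real.log y / 2)) atTop (𝓝 (1 / 2)) := by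
  constructor
  · refine tendsto_mul_sqrt_mul_wallRate_sub_sqrt.congr' ?_
    filter_upwards [eventually_gt_atTop (0 : ℝ)] with y hy
    rw [HV.wallRate_eq_surfaceMu hy]
  · refine tendsto_sq_mul_log_wallRate_sub.congr' ?_
    filter_upwards [eventually_gt_atTop (0 : ℝ)] with y hy
    rw [HV.wallRate_eq_surfaceMu hy]

end Literature.Probability.RandomPlanarGeometry.SAW.HexBW.Wall
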